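/-
Copyright: statement-level skeleton of a published paper (lit-balaban cell, Phase-2 proof seat p13, gen 3). No proof
claims beyond what the kernel checks below.
-/
import Literature.MathematicalPhysics.QuantumFieldTheory.Balaban1983to89.B4Sect5WalkDecay

/-!
# `Balaban1983to89.B4Sect5WalkPerturb` — T. Bałaban, *Regularity and decay of lattice Green's functions*, Commun.
Math. Phys. **89** (1983) 571–597 [Balaban1983RegularityDecay] (= B4), Sect. 5, pp. 596–597 [PDF 26–27]:
**(5.24)–(5.27) ⇒ (5.10) ALONG THE PRINTED GENERALIZED RANDOM WALK** — the perturbation estimate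
`|A_Λ^{−1}(x,x′) − (A+B)_Λ^{−1}(x,x′)| ≤ c₁e^{−δ₁(|x−x′| + dist(x,Ω^c) + dist(x′,Ω^c))}` from the difference (5.24) of
the two walk expansions (5.17), the defect bounds (5.25) (`‖R(B)_{j,j′}‖`) and (5.26)–(5.27)
(`C(A)_j − C(A+B)_j = A_{□_j}^{−1}B_{□_j}(A+B)_{□_j}^{−1}`), in the `L²` operator norms of the print

statement-level skeleton of published theorems with citation tags; proofs where landed; nothing here is a claim
about the Yang–Mills mass gap

PDF held: `paper:balaban1983-cmp89-regularity-decay` (journal page = PDF page + 570); page renders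
`run/shared/lean/pub/pub-balaban/b2b-balaban-ref1/pages/1983-cmp89-regularity-decay/…-p026/027-x2.png`; verbatim
text from the cell transcript `run/shared/lean/pub/pub-balaban/b2b-balaban-b04/transcript-B4.md` ll. 336–392.

CITATION HEADER (lean-in-tree rule).  Part of the lit-balaban TYPED SKELETON (HOME `run/shared/lean/pub/lit-balaban/`):
WHAT IS REPRODUCED = row **B4.Eq5.15** of `HOME/lit-balaban-r01/ROWS-B4.md`, members **(5.24), (5.25), (5.26),
(5.27)** and the conclusion **(5.10)** they prove (the row's cell reads «(5.22)–(5.27) absent as displays —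
conclusions (5.8)/(5.10) = `B4Sect5Proof`»; INTERFACES §3 row F-T4-410: the NE spine cites B4 (5.19)–(5.24)).  Unit
`lit-balaban-p13` (gen 3); owner r01; referee ref-4.  Fourth file of the seat's Sect.-5 chain: `B4Sect5RandomWalk`
(p244548), `B4Sect5CubeBounds` (p245229/p245700) and `B4Sect5WalkDecay` (p247099: (5.18)/(5.20)/(5.21) ⇒ (5.7), whose
`L²` toolkit, weighted Schur line and support lemmas are used by name) are IMPORTED; nothing landed is edited.

THE PRINTED TEXT (verbatim, p. 594 and pp. 596–597 [PDF 24, 26–27]).  *"If we perturb the operator A by an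
operator B such that the condition (5.6) is satisfied for A + B, and additionally B has the property
|B(x,x′)| ≤ c₀e^{−δ₀(|x−x′| + dist(x,Ω^c) + dist(x′,Ω^c))}, x, x′ ∈ Ω, (5.9) then we have also
|A_Λ^{−1}(x,x′) − (A+B)_Λ^{−1}(x,x′)| ≤ c₁e^{−δ₁(|x−x′| + dist(x,Ω^c) + dist(x′,Ω^c))}, x, x′ ∈ Λ. (5.10)"* […] *"A proof
of the last inequality (5.10) is very similar, although a little bit more awkward. We form the representations
(5.17) for A_Λ^{−1} and (A+B)_Λ^{−1}, and we take their difference: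
A_Λ^{−1} − (A+B)_Λ^{−1} = Σ_ω[h_{ω₀}C(A)_{ω₀}h_{ω₀}R(A)_{ω₁,ω₂}C(A)_{ω₂}h_{ω₂}·…·R(A)_{ω_{2n−1},ω_{2n}}C(A)_{ω_{2n}}h_{ω_{2n}}
− h_{ω₀}C(A+B)_{ω₀}h_{ω₀}R(A+B)_{ω₁,ω₂}C(A+B)_{ω₂}h_{ω₂}·…·R(A+B)_{ω_{2n−1},ω_{2n}}C(A+B)_{ω_{2n}}h_{ω_{2n}}]
= Σ_ω[h_{ω₀}(C(A)_{ω₀} − C(A+B)_{ω₀})h_{ω₀}R(A)_{ω₁,ω₂}C(A)_{ω₂}h_{ω₂}·… + h_{ω₀}C(A+B)_{ω₀}h_{ω₀}(R(A)_{ω₁,ω₂} −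
R(A+B)_{ω₁,ω₂})·C(A)_{ω₂}h_{ω₂}·… + …]. (5.24)  From the definition (5.14) of the operators R_{j,j′} we have
R(A)_{j,j′} − R(A+B)_{j,j′} = −R(B)_{j,j′}, and from the condition (5.9), we get the estimate
‖R(B)_{j,j′}‖ ≤ αe^{−δ₂|j−j′|}e^{−δ₀(dist(□_j,Ω^c) + dist(□_{j′},Ω^c))}. (5.25)  Further we have
C(A)_j − C(A+B)_j = A_{□_j}^{−1} − (A+B)_{□_j}^{−1} = A_{□_j}^{−1}B_{□_j}(A+B)_{□_j}^{−1}, (5.26) and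
‖C(A)_j − C(A+B)_j‖ ≤ γ₀^{−2}c′₀e^{−2δ₀dist(□_j,Ω^c)}. (5.27)  The equality (5.24) and the above estimates imply
|A_Λ^{−1}(x,x′) − (A+B)_Λ^{−1}(x,x′)| ≤ Σ_{ω: x∈□_{ω₀}, x′∈□_{ω_{2n}}} c′₀γ₀^{−(n+2)}αⁿ(e^{dδ₂})ⁿ e^{−δ₂|ω₀−ω₁|}·…·
e^{−δ₂|ω_{2n−1}−ω_{2n}|}·(Σ_{i=1}^n e^{−2δ₀dist(□_{ω_{2i}},Ω^c)} + Σ_{i=1}^n e^{−δ₀(dist(□_{ω_{2i−1}},Ω^c) + dist(□_{ω_{2i}},Ω^c))})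
≤ e^{−⅓δ₂M^{−1}(dist(x,Ω^c) + dist(x′,Ω^c))}γ₀^{−2}c′₀e^{2dδ₂}(1 − γ₀^{−1}4e^{dδ₂}c₂^{2d}α)^{−1}e^{−⅓δ₂M^{−1}|x−x′|}.
Thus Inequality (5.10) is proved. The constants δ₁, c₁ are functions of δ₀, γ₀, c₀, and from the above proof we
can get more precise estimates for them."*

THE TYPING (what is proved, and not more).
* SETTING = that of `B4Sect5WalkDecay`: a finite `Λ ⊂ ℤ^d`, operators `A`, `A + B` on `L²(Λ; ℝ^N)` (the print's
  `A_Λ`, `(A+B)_Λ = A_Λ + B_Λ`; index type `B4.Idx Λ N`), both with (5.6) (`B4.Hyp56 Λ · γ₀ c₀ δ₀`, as the Theorem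
  demands *"the condition (5.6) is satisfied for A + B"*); ONE cube system (5.11)–(5.12) (`labels`, `pFam`,
  `hFam`) for both, local inverses `cFam M A`, `cFam M (A + B)`.  The boundary distance *"dist(x,Ω^c)"* of (5.9) is
  carried as a function `D : ℤ^d → ℝ` with `D ≥ 0` and `D(x) ≤ D(y) + |x − y|` (for `B_Λ`, `Λ ⊆ Ω`, (5.9) holds with
  `D = dist(·,Ω^c)` of the LARGER domain — `Metric.infDist · (Ωᶜ)`, as in `B4.Hyp59`/`B4.Concl510` — and these two
  properties are all the proof uses); (5.9) is the hypothesis `|B(x,x′)| ≤ c₀e^{−δ₀(|x−x′| + D(x) + D(x′))}`.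
  `|x − x′|` = sup-distance; `δ₂ = ¼δ₀`, `α = alpha515 d N c₀ δ₀ M` (from `B4Sect5CubeBounds.ineq515_l2`); norms = `L²`
  operator norms (`Matrix.Norms.L2Operator`), as in `B4Sect5WalkDecay`.
* (5.24): the per-walk telescoping is the NORM BOUND `norm_mul_bprod_sub_le` (abstract: `‖x·Πb − x′·Πb′‖ ≤
  (‖x − x′‖ + nη‖x′‖)·Πβ` when `‖b‖, ‖b′‖ ≤ β` and `‖b − b′‖ ≤ ηβ` along the walk) and the two expansions are
  subtracted termwise as `HasSum`s (`hasSum_walkTerm_sub_apply`); *"R(A)_{j,j′} − R(A+B)_{j,j′} = −R(B)_{j,j′}"* is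
  `rPair_sub_rPair_add` (`rPair` is additive in the operator, `rPair_add`).
* (5.25): `l2norm_rPair_pert_le` — `‖R(B)_{j,j′}‖ ≤ αe^{−δ₂|j−j′|}e^{−δ₀(t + t′)}` for every `t ≤ D` on `□_j`, `t′ ≤ D`
  on `□_{j′}` (the print's `dist(□_j,Ω^c)` is the largest such `t`): `R(X)_{j,j′}` only sees `□_jX□_{j′}`
  (`rPair_mask`), whose kernel obeys (5.6)'s bound with constant `c₀e^{−δ₀(t+t′)}`, so (5.15) (`ineq515_l2`) applies
  (`α` is linear in `c₀`, `alpha515_mul`).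
* (5.26): `cOp_sub_cOp_eq` (resolvent identity `B4Sect5Proof.inv_sub_inv_eq` on `L²(□_j)`, extended by zero).
  (5.27): `l2norm_cOp_sub_cOp_le` — `‖C(A)_j − C(A+B)_j‖ ≤ γ₀^{−2}c′₀e^{−2δ₀t}`, `t ≤ D` on `□_j`, with
  `c′₀ = c₀NK_d(δ₀)` (`‖A_{□}^{−1}‖, ‖(A+B)_{□}^{−1}‖ ≤ γ₀^{−1}` by coercivity, `QGQInverse.inv_mulVec_sq_le`; `‖B_{□_j}‖` by
  the Schur test `SchurTest.sum_sq_le` on (5.9)).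
* THE FINAL ESTIMATE: per walk `ω = (ω₀; pairs)` through `x ∈ □_{ω₀}`, `x′ ∈ □_{ω_{2n}}`, every cube `□_l` of the walk
  has `D ≥ t_ω := ½(D(x)+D(x′)) − (3/2)M(L_ω + 2)` on it, `L_ω = Σ_i(1 + |ω_{2i−1} − ω_{2i}|)` ≥ the walk's length
  (`walk_label_dist_le`, `ref_le_D`: `D` is 1-Lipschitz and `|x − y| ≤ M(|ω₀ − l| + 2)`), so all defect factors carry
  `e^{−2δ₀t_ω⁺} ≤ e^{−(δ₀/(48M))(D(x)+D(x′))}e^{δ₀/8}e^{(δ₀/16)L_ω}` (`norm_walkTerm_sub_le`, `abs_walkTerm_sub_apply_le`: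
  `‖term(A)_ω − term(A+B)_ω‖ ≤ (n+1)κγ₀^{−1}e^{−2δ₀t}Π_iαγ₀^{−1}e^{−δ₂|ω_{2i−1}−ω_{2i}|}`, `κ = 1 + γ₀^{−1}c′₀`, the print's
  `Σ_{i}` over defect positions = the factor `n + 1`); the growth `e^{(δ₀/16)L_ω}` and the end weight
  `e^{(δ₀/16)|ω₀ − ω_{2n}|}` (converted into `e^{−(δ₀/(16M))|x−x′|}` as in (5.21)) are paid from the decay
  `e^{−δ₂|ω_{2i−1}−ω_{2i}|}` by the weighted Schur line `level_walk_sum_le` (per-step weight `e^{(δ₀/8)(1+|ω_{2i−1}−ω_{2i}|)}`,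
  `sum_weight_beta_le`: the same `θ_W(M) = 3^dK_d(δ₀/8)e^{δ₀/8}αγ₀^{−1}` as in `B4Sect5WalkDecay`), and
  `(n+1)θ_Wⁿ ≤ (2θ_W)ⁿ` (the print's *"4e^{dδ₂}c₂^{2d}α"*): `abs_inv_sub_inv_apply_le_of_walk` —
  `|A_Λ^{−1}(x,x′) − (A+B)_Λ^{−1}(x,x′)| ≤ 2^dκγ₀^{−1}e^{δ₀/4}(1 − 2θ_W)^{−1}e^{−(δ₀/(48M))(|x−x′| + D(x) + D(x′))}` for
  `M ≥ 5`, `M > K_R`, `M > Θ₁`, `2θ_W(M) < 1`.  **`concl510_walk`**: *"we fix M"* — constants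
  `c₁ = 2^{d+1}κγ₀^{−1}e^{δ₀/4}`, `δ₁ = δ₀/(48M₂(d,N,γ₀,c₀,δ₀))`, functions of `d, N, γ₀, c₀, δ₀` only, for EVERY finite `Λ`
  and all `A, B, D` as above; **`concl510_compress_walk`**: the printed form, `B4.Concl510 Ω Λ h A B c₁ δ₁` for
  every finite `Ω`, every `Λ ⊆ Ω`, `A`, `A + B` with (5.6) on `Ω` and `B` with (5.9) (`B4.Hyp59 Ω B c₀ δ₀`).
  DIVERGENCE (method, not statement): sup-distance and elementary convolution bound as in `B4Sect5WalkDecay`; the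
  print's rate `⅓δ₂M^{−1}` becomes `δ₀/(48M)`; constants are not optimized (*"from the above proof we can get more
  precise estimates for them"*).
* NOT HERE: (5.22)–(5.23) (⇒ (5.8)).  No `def` is introduced (`θ_W`, `κ`, `c′₀`, `t_ω`, `L_ω` are abbreviations of
  this docstring only).
-/

namespace Literature.MathematicalPhysics.QuantumFieldTheory.Balaban1983to89.B4Sect5WalkPerturb

open scoped BigOperators
open Finset Matrix

/-! ## §0 (5.24) abstractly: telescoping, walk geometry, and the weighted Schur line with a walk indicator -/

section Abstract

open Literature.MathematicalPhysics.QuantumFieldTheory.Balaban1983to89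
open B4RandomWalk213 B4Sect5RandomWalk

variable {R : Type*} [NormedRing R] {J : Type*} [Fintype J]

/-- **(5.24), THE TELESCOPING, as a norm bound.**  *"Σ_ω[h(C(A) − C(A+B))hR(A)C(A)h·… + hC(A+B)h(R(A) − R(A+B))
·C(A)h·… + …]"*: if the pair factors of both expansions are bounded by the same `β` and, along the walk `ys`, the
defects by `ηβ`, then `‖x·b(ys 0)⋯b(ys (n−1)) − x′·b′(ys 0)⋯b′(ys (n−1))‖ ≤ (‖x − x′‖ + nη‖x′‖)·Π_i β(ys i)` — one
defect position at a time, all other factors at their norm bounds. [cite: Balaban1983RegularityDecay, (5.24) p.596] -/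
theorem norm_mul_bprod_sub_le {ι : Type*} {b b' : ι → R} {β : ι → ℝ} {η : ℝ} (hη : 0 ≤ η)
    (hβ : ∀ i, ‖b i‖ ≤ β i) (hβ' : ∀ i, ‖b' i‖ ≤ β i) :
    ∀ (n : ℕ) (x x' : R) (ys : Fin n → ι), (∀ k, ‖b (ys k) - b' (ys k)‖ ≤ η * β (ys k)) →
      ‖x * bprod b n ys - x' * bprod b' n ys‖ ≤ (‖x - x'‖ + n * η * ‖x'‖) * ∏ i, β (ys i) := by
  intro n
  induction n with
  | zero =>
      intro x x' ys _
      simp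
  | succ n ih =>
      intro x x' ys hd
      have hβ0 : ∀ i, 0 ≤ β i := fun i => (norm_nonneg _).trans (hβ i)
      rw [bprod_succ, bprod_succ, ← mul_assoc, ← mul_assoc, Fin.prod_univ_succ]
      have h1 := ih (x * b (ys 0)) (x' * b' (ys 0)) (Fin.tail ys) (fun k => hd k.succ)
      have h2 : ‖x * b (ys 0) - x' * b' (ys 0)‖ ≤ ‖x - x'‖ * β (ys 0) + ‖x'‖ * (η * β (ys 0)) := by
        have e : x * b (ys 0) - x' * b' (ys 0) = (x - x') * b (ys 0) + x' * (b (ys 0) - b' (ys 0)) := by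
          simp only [sub_mul, mul_sub]; abel
        rw [e]
        refine (norm_add_le _ _).trans (add_le_add ?_ ?_)
        · exact (norm_mul_le _ _).trans (mul_le_mul_of_nonneg_left (hβ _) (norm_nonneg _))
        · exact (norm_mul_le _ _).trans (mul_le_mul_of_nonneg_left (hd 0) (norm_nonneg _))
      have h3 : ‖x' * b' (ys 0)‖ ≤ ‖x'‖ * β (ys 0) :=
        (norm_mul_le _ _).trans (mul_le_mul_of_nonneg_left (hβ' _) (norm_nonneg _))
      have hP : 0 ≤ ∏ i : Fin n, β (Fin.tail ys i) := Finset.prod_nonneg fun i _ => hβ0 _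
      calc ‖x * b (ys 0) * bprod b n (Fin.tail ys) - x' * b' (ys 0) * bprod b' n (Fin.tail ys)‖
          ≤ (‖x * b (ys 0) - x' * b' (ys 0)‖ + n * η * ‖x' * b' (ys 0)‖) * ∏ i, β (Fin.tail ys i) := h1
        _ ≤ ((‖x - x'‖ * β (ys 0) + ‖x'‖ * (η * β (ys 0))) + n * η * (‖x'‖ * β (ys 0))) *
              ∏ i, β (Fin.tail ys i) := by
            apply mul_le_mul_of_nonneg_right _ hP
            exact add_le_add h2 (mul_le_mul_of_nonneg_left h3 (by positivity))
        _ = (‖x - x'‖ + (↑(n + 1) : ℝ) * η * ‖x'‖) * (β (ys 0) * ∏ i : Fin n, β (ys i.succ)) := by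
            push_cast
            have : (∏ i : Fin n, β (Fin.tail ys i)) = ∏ i : Fin n, β (ys i.succ) := rfl
            rw [this]; ring

omit [Fintype J] in
/-- **WALK GEOMETRY** behind *"dist(□_{ω_i},Ω^c)"* ↔ *"dist(x,Ω^c) + dist(x′,Ω^c)"*: along a walk obeying the
restriction (5.17) (`ω_{2i} ~ ω_{2i+1}`), every label `ω_{2i−1}`, `ω_{2i}` is within `L_ω = Σ_i (1 + |ω_{2i−1} − ω_{2i}|)`
of the start `ω₀` (for any pseudo-distance `≤ 1` on adjacent labels). [cite: Balaban1983RegularityDecay, (5.17)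
p.595; p.597 (display after (5.27))] -/
theorem walk_label_dist_le (adj : J → J → Prop) (dJ : J → J → ℝ) (hnn : ∀ a b, 0 ≤ dJ a b)
    (htri : ∀ a b c, dJ a c ≤ dJ a b + dJ b c) (hadj : ∀ a b, adj a b → dJ a b ≤ 1) :
    ∀ (n : ℕ) (q₀ : J × J) (ys : Fin n → J × J), IsWalk (fun q q' : J × J => adj q.2 q'.1) q₀ ys →
      ∀ i, dJ q₀.2 (ys i).1 ≤ ∑ k, (1 + dJ (ys k).1 (ys k).2) ∧
        dJ q₀.2 (ys i).2 ≤ ∑ k, (1 + dJ (ys k).1 (ys k).2) := by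
  intro n
  induction n with
  | zero => intro q₀ ys _ i; exact i.elim0
  | succ n ih =>
      intro q₀ ys hw
      have hw' := (isWalk_succ (adj := fun q q' : J × J => adj q.2 q'.1)).mp hw
      obtain ⟨h0, htail⟩ := hw'
      have hS : ∑ k : Fin (n + 1), (1 + dJ (ys k).1 (ys k).2) =
          (1 + dJ (ys 0).1 (ys 0).2) + ∑ k : Fin n, (1 + dJ (Fin.tail ys k).1 (Fin.tail ys k).2) :=
        Fin.sum_univ_succ _
      have hT0 : 0 ≤ ∑ k : Fin n, (1 + dJ (Fin.tail ys k).1 (Fin.tail ys k).2) :=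
        Finset.sum_nonneg fun k _ => by have := hnn (Fin.tail ys k).1 (Fin.tail ys k).2; positivity
      have h01 : dJ q₀.2 (ys 0).1 ≤ 1 := hadj _ _ h0
      have h02 : dJ q₀.2 (ys 0).2 ≤ 1 + dJ (ys 0).1 (ys 0).2 := by
        have := htri q₀.2 (ys 0).1 (ys 0).2; linarith
      intro i
      refine Fin.cases ?_ (fun k => ?_) i
      · rw [hS]
        have := hnn (ys 0).1 (ys 0).2
        constructor <;> linarith
      · have hk := ih (ys 0) (Fin.tail ys) htail k
        have e : Fin.tail ys k = ys k.succ := rfl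
        rw [e] at hk
        rw [hS]
        have t1 := htri q₀.2 (ys 0).2 (ys k.succ).1
        have t2 := htri q₀.2 (ys 0).2 (ys k.succ).2
        constructor <;> linarith [hk.1, hk.2]

omit [Fintype J] in
/-- … and so is the end label `ω_{2n}` (`= ω₀` for `n = 0`). [cite: Balaban1983RegularityDecay, (5.17) p.595; p.597]
-/
theorem walk_lastPt_dist_le (adj : J → J → Prop) (dJ : J → J → ℝ) (hnn : ∀ a b, 0 ≤ dJ a b)
    (hself : ∀ a, dJ a a = 0)
    (htri : ∀ a b c, dJ a c ≤ dJ a b + dJ b c) (hadj : ∀ a b, adj a b → dJ a b ≤ 1)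
    (n : ℕ) (q₀ : J × J) (ys : Fin n → J × J) (hw : IsWalk (fun q q' : J × J => adj q.2 q'.1) q₀ ys) :
    dJ q₀.2 (lastPt q₀.2 n (fun i => (ys i).2)) ≤ ∑ k, (1 + dJ (ys k).1 (ys k).2) := by
  cases n with
  | zero =>
      rw [lastPt_zero, hself]
      exact Finset.sum_nonneg fun k _ => by have := hnn (ys k).1 (ys k).2; positivity
  | succ n =>
      rw [lastPt_succ]
      exact (walk_label_dist_le adj dJ hnn htri hadj (n + 1) q₀ ys hw (Fin.last n)).2

/-- **THE WEIGHTED SCHUR LINE WITH A WALK INDICATOR** (the summation of p. 597, *"Σ_{ω: x∈□_{ω₀}, x′∈□_{ω_{2n}}}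
c′₀γ₀^{−(n+2)}αⁿ(e^{dδ₂})ⁿe^{−δ₂|ω₀−ω₁|}·…"*, organised as in (5.18)–(5.20)): if `F ≤ K·e^{ε d(ω₀,ω_{2n})}·Π_i w(pair_i)`
on the walks from `q₀` and `F ≤ 0` off them, and the successor weight is `Σ_{(l₁,l′): l ~ l₁} e^{ε(1 + d(l₁,l′))}
w(l₁,l′) ≤ θ` for every `l`, then `Σ_{pairs} F ≤ Kθⁿ`. [cite: Balaban1983RegularityDecay, (5.18)–(5.20)
pp.595–596; p.597] -/
theorem level_walk_sum_le (adj : J → J → Prop) [DecidableRel adj] (dJ : J → J → ℝ)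
    (hself : ∀ a, dJ a a = 0)
    (htri : ∀ a b c, dJ a c ≤ dJ a b + dJ b c) (hadj : ∀ a b, adj a b → dJ a b ≤ 1)
    {w : J × J → ℝ} (hw : ∀ q, 0 ≤ w q) {ε θ : ℝ} (hε : 0 ≤ ε)
    (hθ : ∀ l : J, ∑ q ∈ Finset.univ.filter (fun q : J × J => adj l q.1),
      Real.exp (ε * (1 + dJ q.1 q.2)) * w q ≤ θ) :
    ∀ (n : ℕ) (q₀ : J × J) (F : (Fin n → J × J) → ℝ) (K : ℝ), 0 ≤ K →
      (∀ ys, IsWalk (fun q q' : J × J => adj q.2 q'.1) q₀ ys →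
        F ys ≤ K * (Real.exp (ε * dJ q₀.2 (lastPt q₀.2 n (fun i => (ys i).2))) * ∏ i, w (ys i))) →
      (∀ ys, ¬ IsWalk (fun q q' : J × J => adj q.2 q'.1) q₀ ys → F ys ≤ 0) →
      ∑ ys, F ys ≤ K * θ ^ n := by
  intro n
  induction n with
  | zero =>
      intro q₀ F K hK hF _
      rw [Fintype.sum_unique, pow_zero, mul_one]
      have := hF default (isWalk_zero _ _ _)
      simpa [hself] using this
  | succ n ih =>
      intro q₀ F K hK hF hF0
      have hθ0 : 0 ≤ θ :=
        le_trans (Finset.sum_nonneg fun q _ => mul_nonneg (Real.exp_pos _).le (hw q)) (hθ q₀.2)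
      rw [sum_tuple_succ]
      have hq : ∀ q : J × J, ∑ ys' : Fin n → J × J, F (Fin.cons q ys') ≤
          (if adj q₀.2 q.1 then K * (Real.exp (ε * (1 + dJ q.1 q.2)) * w q) else 0) * θ ^ n := by
        intro q
        by_cases hadj' : adj q₀.2 q.1
        · rw [if_pos hadj']
          refine ih q (fun ys' => F (Fin.cons q ys')) _
            (mul_nonneg hK (mul_nonneg (Real.exp_pos _).le (hw q))) (fun ys' hw' => ?_) (fun ys' hw' => ?_)
          · have hcons : IsWalk (fun q q' : J × J => adj q.2 q'.1) q₀ (Fin.cons q ys' : Fin (n + 1) → J × J) :=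
              isWalk_cons.mpr ⟨hadj', hw'⟩
            have h := hF _ hcons
            have hlast : (fun i => ((Fin.cons q ys' : Fin (n + 1) → J × J) i).2) =
                (Fin.cons q.2 (fun i => (ys' i).2) : Fin (n + 1) → J) := by
              funext i; refine Fin.cases ?_ (fun k => ?_) i <;> simp
            rw [hlast, lastPt_cons, Fin.prod_univ_succ] at h
            simp only [Fin.cons_zero, Fin.cons_succ] at h
            have hexp : Real.exp (ε * dJ q₀.2 (lastPt q.2 n fun i => (ys' i).2)) ≤
                Real.exp (ε * (1 + dJ q.1 q.2)) * Real.exp (ε * dJ q.2 (lastPt q.2 n fun i => (ys' i).2)) := by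
              rw [← Real.exp_add]
              apply Real.exp_le_exp.mpr
              have t1 := htri q₀.2 q.1 (lastPt q.2 n fun i => (ys' i).2)
              have t2 := htri q.1 q.2 (lastPt q.2 n fun i => (ys' i).2)
              have t3 := hadj _ _ hadj'
              have t4 : dJ q₀.2 (lastPt q.2 n fun i => (ys' i).2) ≤
                  1 + dJ q.1 q.2 + dJ q.2 (lastPt q.2 n fun i => (ys' i).2) := by linarith
              have := mul_le_mul_of_nonneg_left t4 hε
              linarith
            have hP : 0 ≤ ∏ i : Fin n, w (ys' i) := Finset.prod_nonneg fun i _ => hw _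
            calc F (Fin.cons q ys')
                ≤ K * (Real.exp (ε * dJ q₀.2 (lastPt q.2 n fun i => (ys' i).2)) *
                    (w q * ∏ i : Fin n, w (ys' i))) := h
              _ ≤ K * ((Real.exp (ε * (1 + dJ q.1 q.2)) *
                    Real.exp (ε * dJ q.2 (lastPt q.2 n fun i => (ys' i).2))) *
                    (w q * ∏ i : Fin n, w (ys' i))) :=
                  mul_le_mul_of_nonneg_left (mul_le_mul_of_nonneg_right hexp (mul_nonneg (hw q) hP)) hK
              _ = _ := by ring
          · exact hF0 _ (fun h => hw' (isWalk_cons.mp h).2)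
        · rw [if_neg hadj', zero_mul]
          exact Finset.sum_nonpos fun ys' _ => hF0 _ (fun h => hadj' (isWalk_cons.mp h).1)
      calc ∑ q, ∑ ys' : Fin n → J × J, F (Fin.cons q ys')
          ≤ ∑ q, (if adj q₀.2 q.1 then K * (Real.exp (ε * (1 + dJ q.1 q.2)) * w q) else 0) * θ ^ n :=
            Finset.sum_le_sum fun q _ => hq q
        _ = K * (∑ q ∈ Finset.univ.filter (fun q : J × J => adj q₀.2 q.1),
              Real.exp (ε * (1 + dJ q.1 q.2)) * w q) * θ ^ n := by
            rw [Finset.sum_filter, Finset.mul_sum, Finset.sum_mul]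
            refine Finset.sum_congr rfl fun q _ => ?_
            split_ifs <;> ring
        _ ≤ K * θ * θ ^ n :=
            mul_le_mul_of_nonneg_right (mul_le_mul_of_nonneg_left (hθ q₀.2) hK) (pow_nonneg hθ0 n)
        _ = K * θ ^ (n + 1) := by ring

end Abstract

/-! ## §1 (5.25)–(5.27) on `L²(Λ; ℝ^N)`: `R(A) − R(A+B) = −R(B)`, the mask, `C(A)_j − C(A+B)_j` -/

section LatticeAlgebra

open Literature.MathematicalPhysics.QuantumFieldTheory.Balaban1983to89
open B4Commutators25to211 B4Sect5RandomWalk B4Sect5Proof B6GOmega B4Sect5CubeBounds B4RandomWalk213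
  B4Sect5WalkDecay
open scoped Matrix.Norms.L2Operator

variable {d N : ℕ} {Λ : Finset (Fin d → ℤ)} {γ₀ c₀ δ₀ : ℝ}

/-- `R_{j,j′}` of (5.14) is ADDITIVE in the operator: `R(X + Y)_{j,j′} = R(X)_{j,j′} + R(Y)_{j,j′}`. [cite:
Balaban1983RegularityDecay, (5.14) p.595; p.597 "From the definition (5.14)"] -/
theorem rPair_add {R : Type*} [Ring R] {J : Type*} [DecidableEq J] (X Y : R) (p h : J → R) (j j' : J) :
    rPair (X + Y) p h j j' = rPair X p h j j' + rPair Y p h j j' := by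
  unfold rPair
  split_ifs <;> noncomm_ring

/-- p. 597, verbatim: *"From the definition (5.14) of the operators R_{j,j′} we have R(A)_{j,j′} − R(A+B)_{j,j′} =
−R(B)_{j,j′}"*. [cite: Balaban1983RegularityDecay, p.597 (line before (5.25))] -/
theorem rPair_sub_rPair_add {R : Type*} [Ring R] {J : Type*} [DecidableEq J] (X Y : R) (p h : J → R)
    (j j' : J) : rPair X p h j j' - rPair (X + Y) p h j j' = -rPair Y p h j j' := by
  rw [rPair_add]; abel

/-- entries of `□_lX□_{l′}`: `□_l(x)X(x,x′)□_{l′}(x′)`. [cite: Balaban1983RegularityDecay, (5.11) p.594; (5.14) p.595]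
-/
theorem pFam_mul_mul_pFam_apply (M : ℕ) (X : Matrix (B4.Idx Λ N) (B4.Idx Λ N) ℝ) (l l' : ↥(labels M Λ))
    (k k' : B4.Idx Λ N) :
    (pFam N M Λ l * X * pFam N M Λ l') k k' =
      (if InBox M l.1 (k.1 : Fin d → ℤ) then 1 else 0) * X k k' *
        (if InBox M l'.1 (k'.1 : Fin d → ℤ) then 1 else 0) := by
  simp only [pFam]
  rw [mul_mulH_apply, mulH_mul_apply, boxInd_eq, boxInd_eq]

/-- **THE MASK**: *"It is natural to interpret R_{j,j′} as an operator R_{j,j′}: L²(□_{j′}) → L²(□_j)"* (p. 595) —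
`R(X)_{l,l′}` depends on `X` only through `□_lX□_{l′}`: `R(X)_{l,l′} = R(□_lX□_{l′})_{l,l′}` (`supp h ⊆ □`). [cite:
Balaban1983RegularityDecay, (5.14) p.595] -/
theorem rPair_mask {M : ℕ} (hM : 0 < M) (X : Matrix (B4.Idx Λ N) (B4.Idx Λ N) ℝ) (l l' : ↥(labels M Λ)) :
    rPair X (pFam N M Λ) (hFam N M Λ) l l' =
      rPair (pFam N M Λ l * X * pFam N M Λ l') (pFam N M Λ) (hFam N M Λ) l l' := by
  ext k k'
  by_cases hll' : l = l'
  · subst hll'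
    rw [rPair_diag_apply, rPair_diag_apply, pFam_mul_mul_pFam_apply, boxInd_eq, boxInd_eq]
    by_cases hk : InBox M l.1 (k.1 : Fin d → ℤ) <;> by_cases hk' : InBox M l.1 (k'.1 : Fin d → ℤ) <;>
      simp [hk, hk']
  · rw [rPair_offDiag_apply M X hll', rPair_offDiag_apply M _ hll', pFam_mul_mul_pFam_apply, boxInd_eq]
    by_cases hk : InBox M l.1 (k.1 : Fin d → ℤ)
    · by_cases hk' : InBox M l'.1 (k'.1 : Fin d → ℤ)
      · simp [hk, hk']
      · have h0 : hfun M l'.1 (k'.1 : Fin d → ℤ) = 0 := by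
          by_contra h0; exact hk' (inBox_of_hfun_ne_zero hM h0)
        simp [hk', h0]
    · have h0 : hfun M l.1 (k.1 : Fin d → ℤ) = 0 := by
        by_contra h0; exact hk (inBox_of_hfun_ne_zero hM h0)
      simp [hk, h0]

/-- `α` of (5.15) is linear in the kernel constant `c₀`: `α(sc₀) = sα(c₀)` (used with `s = e^{−δ₀(t + t′)}` for
(5.25)). [cite: Balaban1983RegularityDecay, (5.15) p.595] -/
theorem alpha515_mul (s : ℝ) (M : ℕ) : alpha515 d N (s * c₀) δ₀ M = s * alpha515 d N c₀ δ₀ M := by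
  unfold alpha515 weightConst; ring

/-- **(5.9) between two cubes**: if `|B(x,x′)| ≤ c₀e^{−δ₀(|x−x′| + D(x) + D(x′))}` and `D ≥ t` at `x`, `D ≥ t′` at
`x′`, then `|B(x,x′)| ≤ c₀e^{−δ₀(t+t′)}·e^{−δ₀|x−x′|}` — (5.6)'s kernel bound with the small constant
`c₀e^{−δ₀(t+t′)}`. [cite: Balaban1983RegularityDecay, (5.9) p.594; (5.25) p.597] -/
theorem kernel59_le (hc : 0 ≤ c₀) (hδ : 0 ≤ δ₀) {B : Matrix (B4.Idx Λ N) (B4.Idx Λ N) ℝ} {D : (Fin d → ℤ) → ℝ}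
    (hB : ∀ k k' : B4.Idx Λ N, |B k k'| ≤ c₀ * Real.exp (-(δ₀ *
      (dist (k.1 : Fin d → ℤ) (k'.1 : Fin d → ℤ) + D (k.1 : Fin d → ℤ) + D (k'.1 : Fin d → ℤ)))))
    {t t' : ℝ} (k k' : B4.Idx Λ N) (hk : t ≤ D (k.1 : Fin d → ℤ)) (hk' : t' ≤ D (k'.1 : Fin d → ℤ)) :
    |B k k'| ≤ c₀ * Real.exp (-(δ₀ * (t + t'))) *
      Real.exp (-(δ₀ * dist (k.1 : Fin d → ℤ) (k'.1 : Fin d → ℤ))) := by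
  refine (hB k k').trans ?_
  set Δ := dist (k.1 : Fin d → ℤ) (k'.1 : Fin d → ℤ) with hΔ
  have h1 : δ₀ * (t + t') ≤ δ₀ * (D (k.1 : Fin d → ℤ) + D (k'.1 : Fin d → ℤ)) :=
    mul_le_mul_of_nonneg_left (add_le_add hk hk') hδ
  have e : Real.exp (-(δ₀ * (Δ + D (k.1 : Fin d → ℤ) + D (k'.1 : Fin d → ℤ)))) =
      Real.exp (-(δ₀ * (D (k.1 : Fin d → ℤ) + D (k'.1 : Fin d → ℤ)))) * Real.exp (-(δ₀ * Δ)) := by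
    rw [← Real.exp_add]; congr 1; ring
  rw [e, ← mul_assoc]
  exact mul_le_mul_of_nonneg_right
    (mul_le_mul_of_nonneg_left (Real.exp_le_exp.mpr (by linarith)) hc) (Real.exp_pos _).le

/-- **(5.25) PROVED** p. 597 [PDF 27], verbatim: *"and from the condition (5.9), we get the estimate
‖R(B)_{j,j′}‖ ≤ αe^{−δ₂|j−j′|}e^{−δ₀(dist(□_j,Ω^c) + dist(□_{j′},Ω^c))}. (5.25)"* — `L²` operator norm, `δ₂ = ¼δ₀`,
`α = alpha515 d N c₀ δ₀ M`, `M ≥ 5`, for every `t ≤ D` on `□_j` and `t′ ≤ D` on `□_{j′}` (`D` = the boundary distance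
of (5.9); `dist(□_j,Ω^c)` is the largest admissible `t`). [cite: Balaban1983RegularityDecay, (5.25) p.597] -/
theorem l2norm_rPair_pert_le {M : ℕ} (hM : 5 ≤ M) (hc : 0 ≤ c₀) (hδ : 0 < δ₀)
    {B : Matrix (B4.Idx Λ N) (B4.Idx Λ N) ℝ} {D : (Fin d → ℤ) → ℝ}
    (hB : ∀ k k' : B4.Idx Λ N, |B k k'| ≤ c₀ * Real.exp (-(δ₀ *
      (dist (k.1 : Fin d → ℤ) (k'.1 : Fin d → ℤ) + D (k.1 : Fin d → ℤ) + D (k'.1 : Fin d → ℤ)))))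
    (l l' : ↥(labels M Λ)) {t t' : ℝ} (ht : ∀ y : ↥Λ, InBox M l.1 (y : Fin d → ℤ) → t ≤ D y)
    (ht' : ∀ y : ↥Λ, InBox M l'.1 (y : Fin d → ℤ) → t' ≤ D y) :
    ‖rPair B (pFam N M Λ) (hFam N M Λ) l l'‖ ≤
      alpha515 d N c₀ δ₀ M * Real.exp (-(δ₀ / 4 * dist (l.1 : Fin d → ℤ) (l'.1 : Fin d → ℤ))) *
        Real.exp (-(δ₀ * (t + t'))) := by
  have hM0 : 0 < M := by omega
  rw [rPair_mask hM0 B l l']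
  have hker : ∀ k k' : B4.Idx Λ N, |(pFam N M Λ l * B * pFam N M Λ l') k k'| ≤
      (Real.exp (-(δ₀ * (t + t'))) * c₀) * Real.exp (-(δ₀ * dist (k.1 : Fin d → ℤ) (k'.1 : Fin d → ℤ))) := by
    intro k k'
    rw [pFam_mul_mul_pFam_apply]
    by_cases hk : InBox M l.1 (k.1 : Fin d → ℤ)
    · by_cases hk' : InBox M l'.1 (k'.1 : Fin d → ℤ)
      · rw [if_pos hk, if_pos hk', one_mul, mul_one]
        have := kernel59_le hc hδ.le hB k k' (ht k.1 hk) (ht' k'.1 hk')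
        linarith
      · rw [if_neg hk', mul_zero, abs_zero]; positivity
    · rw [if_neg hk, zero_mul, zero_mul, abs_zero]; positivity
  have h := l2norm_rPair_le hM (by positivity) hδ hker l l'
  rw [alpha515_mul] at h
  linarith

/-- **(5.26) PROVED** p. 597 [PDF 27], verbatim: *"Further we have C(A)_j − C(A+B)_j = A_{□_j}^{−1} − (A+B)_{□_j}^{−1} =
A_{□_j}^{−1}B_{□_j}(A+B)_{□_j}^{−1}, (5.26)"* — on `L²(Λ)` (the local inverses extended by zero, `C_j = ιA_{□_j}^{−1}ιᵀ`):
`C(A)_j − C(A+B)_j = ι·A_{□_j}^{−1}B_{□_j}(A+B)_{□_j}^{−1}·ιᵀ`; both compressions are invertible by (5.6) for `A` and for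
`A + B`. [cite: Balaban1983RegularityDecay, (5.26) p.597] -/
theorem cOp_sub_cOp_eq (hγ : 0 < γ₀) (hc : 0 ≤ c₀) (hδ : 0 < δ₀) {A B : Matrix (B4.Idx Λ N) (B4.Idx Λ N) ℝ}
    (hA : B4.Hyp56 Λ A γ₀ c₀ δ₀) (hAB : B4.Hyp56 Λ (A + B) γ₀ c₀ δ₀) (M : ℕ) (j : Fin d → ℤ) :
    cOp M A j - cOp M (A + B) j =
      inclMatrix (N := N) (boxSet_subset M Λ j) *
        ((B4.compress (boxSet_subset M Λ j) A)⁻¹ * B4.compress (boxSet_subset M Λ j) B *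
          (B4.compress (boxSet_subset M Λ j) (A + B))⁻¹) *
        (inclMatrix (N := N) (boxSet_subset M Λ j))ᵀ := by
  have hX : IsUnit (B4.compress (boxSet_subset M Λ j) A) :=
    isUnit_of_hyp56 hγ (hyp56_compress _ hγ.le hc hδ.le hA)
  have hY : IsUnit (B4.compress (boxSet_subset M Λ j) (A + B)) :=
    isUnit_of_hyp56 hγ (hyp56_compress _ hγ.le hc hδ.le hAB)
  rw [cOp, cOp, ← Matrix.sub_mul, ← Matrix.mul_sub, inv_sub_inv_eq hX hY, compress_add_sub]

/-- **(5.27) PROVED** p. 597 [PDF 27], verbatim: *"and ‖C(A)_j − C(A+B)_j‖ ≤ γ₀^{−2}c′₀e^{−2δ₀dist(□_j,Ω^c)}. (5.27)"* —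
`L²` operator norm; `‖A_{□_j}^{−1}‖, ‖(A+B)_{□_j}^{−1}‖ ≤ γ₀^{−1}` by (5.6) (coercivity), `‖B_{□_j}‖ ≤ c′₀e^{−2δ₀t}` by the
Schur test on (5.9) with `c′₀ = c₀NK_d(δ₀)`, for every `t ≤ D` on `□_j`. [cite: Balaban1983RegularityDecay, (5.27)
p.597] -/
theorem l2norm_cOp_sub_cOp_le (hγ : 0 < γ₀) (hc : 0 ≤ c₀) (hδ : 0 < δ₀)
    {A B : Matrix (B4.Idx Λ N) (B4.Idx Λ N) ℝ} (hA : B4.Hyp56 Λ A γ₀ c₀ δ₀)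
    (hAB : B4.Hyp56 Λ (A + B) γ₀ c₀ δ₀) {D : (Fin d → ℤ) → ℝ}
    (hB : ∀ k k' : B4.Idx Λ N, |B k k'| ≤ c₀ * Real.exp (-(δ₀ *
      (dist (k.1 : Fin d → ℤ) (k'.1 : Fin d → ℤ) + D (k.1 : Fin d → ℤ) + D (k'.1 : Fin d → ℤ)))))
    (M : ℕ) (j : Fin d → ℤ) {t : ℝ} (ht : ∀ y : ↥Λ, InBox M j (y : Fin d → ℤ) → t ≤ D y) :
    ‖cOp M A j - cOp M (A + B) j‖ ≤
      γ₀⁻¹ * γ₀⁻¹ * (c₀ * Real.exp (-(2 * δ₀ * t)) * (N * latticeConst d δ₀)) := by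
  rw [cOp_sub_cOp_eq hγ hc hδ hA hAB M j]
  set ι := inclMatrix (N := N) (boxSet_subset M Λ j) with hι
  set X := B4.compress (boxSet_subset M Λ j) A with hX
  set Y := B4.compress (boxSet_subset M Λ j) (A + B) with hY
  set Bb := B4.compress (boxSet_subset M Λ j) B with hBb
  set S := c₀ * Real.exp (-(2 * δ₀ * t)) * (N * latticeConst d δ₀) with hS
  have hK := latticeConst_nonneg d hδ.le
  have hS0 : 0 ≤ S := by positivity
  have hcoeX : QGQInverse.Coercive X γ₀ := coercive_of_hyp56 (hyp56_compress _ hγ.le hc hδ.le hA)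
  have hcoeY : QGQInverse.Coercive Y γ₀ := coercive_of_hyp56 (hyp56_compress _ hγ.le hc hδ.le hAB)
  have hent : ∀ k k' : B4.Idx (boxSet M Λ j) N,
      |Bb k k'| ≤ c₀ * Real.exp (-(2 * δ₀ * t)) *
        Real.exp (-(δ₀ * dist (k.1 : Fin d → ℤ) (k'.1 : Fin d → ℤ))) := by
    intro k k'
    have hk : InBox M j (k.1 : Fin d → ℤ) := (mem_boxSet.mp k.1.2).2
    have hk' : InBox M j (k'.1 : Fin d → ℤ) := (mem_boxSet.mp k'.1.2).2
    have h := kernel59_le hc hδ.le hB (B4.inclIdx (boxSet_subset M Λ j) k)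
      (B4.inclIdx (boxSet_subset M Λ j) k') (ht _ hk) (ht _ hk')
    rw [show -(δ₀ * (t + t)) = -(2 * δ₀ * t) by ring] at h
    exact h
  have hrow : ∀ k : B4.Idx (boxSet M Λ j) N, ∑ k', |Bb k k'| ≤ S := by
    intro k
    calc ∑ k', |Bb k k'| ≤ ∑ k' : B4.Idx (boxSet M Λ j) N, c₀ * Real.exp (-(2 * δ₀ * t)) *
          Real.exp (-(δ₀ * dist (k.1 : Fin d → ℤ) (k'.1 : Fin d → ℤ))) :=
          Finset.sum_le_sum fun k' _ => hent k k'
      _ = c₀ * Real.exp (-(2 * δ₀ * t)) *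
          ∑ k' : B4.Idx (boxSet M Λ j) N, Real.exp (-(δ₀ * dist (k.1 : Fin d → ℤ) (k'.1 : Fin d → ℤ))) := by
          rw [Finset.mul_sum]
      _ ≤ c₀ * Real.exp (-(2 * δ₀ * t)) * (N * latticeConst d δ₀) :=
          mul_le_mul_of_nonneg_left (idxSum_le hδ (boxSet M Λ j) (k.1 : Fin d → ℤ)) (by positivity)
  have hcol : ∀ k' : B4.Idx (boxSet M Λ j) N, ∑ k, |Bb k k'| ≤ S := by
    intro k'
    calc ∑ k, |Bb k k'| ≤ ∑ k : B4.Idx (boxSet M Λ j) N, c₀ * Real.exp (-(2 * δ₀ * t)) *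
          Real.exp (-(δ₀ * dist (k'.1 : Fin d → ℤ) (k.1 : Fin d → ℤ))) :=
          Finset.sum_le_sum fun k _ => by rw [dist_comm]; exact hent k k'
      _ = c₀ * Real.exp (-(2 * δ₀ * t)) *
          ∑ k : B4.Idx (boxSet M Λ j) N, Real.exp (-(δ₀ * dist (k'.1 : Fin d → ℤ) (k.1 : Fin d → ℤ))) := by
          rw [Finset.mul_sum]
      _ ≤ c₀ * Real.exp (-(2 * δ₀ * t)) * (N * latticeConst d δ₀) :=
          mul_le_mul_of_nonneg_left (idxSum_le hδ (boxSet M Λ j) (k'.1 : Fin d → ℤ)) (by positivity)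
  refine l2norm_le_of_sq _ (by positivity) fun φ => ?_
  have e : (ι * (X⁻¹ * Bb * Y⁻¹) * ιᵀ) *ᵥ φ = ι *ᵥ (X⁻¹ *ᵥ (Bb *ᵥ (Y⁻¹ *ᵥ (ιᵀ *ᵥ φ)))) := by
    simp only [Matrix.mulVec_mulVec, Matrix.mul_assoc]
  rw [e, inclMatrix_normSq]
  set w := ιᵀ *ᵥ φ with hw
  set u := Y⁻¹ *ᵥ w with hu
  set v := Bb *ᵥ u with hv
  have key : ∀ {T : Matrix (B4.Idx (boxSet M Λ j) N) (B4.Idx (boxSet M Λ j) N) ℝ}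
      (_ : QGQInverse.Coercive T γ₀) (y : B4.Idx (boxSet M Λ j) N → ℝ),
      ∑ k, (T⁻¹ *ᵥ y) k ^ 2 ≤ γ₀⁻¹ ^ 2 * ∑ k, y k ^ 2 := by
    intro T hT y
    have h1 := QGQInverse.inv_mulVec_sq_le hγ hT y
    have e1 : (T⁻¹ *ᵥ y) ⬝ᵥ (T⁻¹ *ᵥ y) = ∑ k, (T⁻¹ *ᵥ y) k ^ 2 := by simp [dotProduct, pow_two]
    have e2 : y ⬝ᵥ y = ∑ k, y k ^ 2 := by simp [dotProduct, pow_two]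
    rw [e1, e2] at h1
    rw [inv_pow, ← div_eq_inv_mul, le_div_iff₀ (by positivity)]
    linarith
  have h2 : ∑ k, v k ^ 2 ≤ S ^ 2 * ∑ k, u k ^ 2 := by
    have h := SchurTest.sum_sq_le (fun k k' => Bb k k') u hrow hcol
    rw [hv]
    simp only [Matrix.mulVec, dotProduct]
    rw [sq]
    exact h
  have h4 : ∑ k, w k ^ 2 ≤ ∑ p, φ p ^ 2 :=
    sum_sq_transpose_inclMatrix_mulVec_le (N := N) (boxSet_subset M Λ j) φ
  calc ∑ k, (X⁻¹ *ᵥ v) k ^ 2 ≤ γ₀⁻¹ ^ 2 * ∑ k, v k ^ 2 := key hcoeX v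
    _ ≤ γ₀⁻¹ ^ 2 * (S ^ 2 * ∑ k, u k ^ 2) := by gcongr
    _ ≤ γ₀⁻¹ ^ 2 * (S ^ 2 * (γ₀⁻¹ ^ 2 * ∑ k, w k ^ 2)) := by gcongr; exact key hcoeY w
    _ ≤ γ₀⁻¹ ^ 2 * (S ^ 2 * (γ₀⁻¹ ^ 2 * ∑ p, φ p ^ 2)) := by gcongr
    _ = (γ₀⁻¹ * γ₀⁻¹ * S) ^ 2 * ∑ p, φ p ^ 2 := by ring

end LatticeAlgebra

/-! ## §2 The defects along one walk: *"dist(□_{ω_i},Ω^c)"* against `dist(x,Ω^c) + dist(x′,Ω^c)` -/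

section PerWalk

open Literature.MathematicalPhysics.QuantumFieldTheory.Balaban1983to89
open B4Commutators25to211 B4Sect5RandomWalk B4Sect5Proof B6GOmega B4Sect5CubeBounds B4RandomWalk213
  B4Sect5WalkDecay
open scoped Matrix.Norms.L2Operator

variable {d N : ℕ} {Λ : Finset (Fin d → ℤ)} {γ₀ c₀ δ₀ : ℝ}

/-- **THE REFERENCE LOWER BOUND FOR `D` ON A CUBE OF THE WALK**: if `x ∈ □_j`, `x′ ∈ □_e`, `y ∈ □_l` with
`|j − l|, |j − e| ≤ L` and `D` is 1-Lipschitz, then `D(y) ≥ ½(D(x) + D(x′)) − (3/2)M(L + 2)` — the exchange of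
*"dist(□_{ω_i},Ω^c)"* for *"dist(x,Ω^c) + dist(x′,Ω^c)"* at the cost of the walk's length in the final display of
p. 597. [cite: Balaban1983RegularityDecay, p.597 (display after (5.27))] -/
theorem ref_le_D {D : (Fin d → ℤ) → ℝ} (hD1 : ∀ x y : Fin d → ℤ, D x ≤ D y + dist x y) {M : ℕ}
    {j l e x x' y : Fin d → ℤ} {L : ℝ} (hx : InBox M j x) (hx' : InBox M e x') (hy : InBox M l y)
    (hl : dist j l ≤ L) (he : dist j e ≤ L) :
    (D x + D x') / 2 - 3 / 2 * (M * (L + 2)) ≤ D y := by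
  have h1 : dist x y ≤ M * (dist j l + 2) := dist_le_of_inBox hx hy
  have h2 : dist x x' ≤ M * (dist j e + 2) := dist_le_of_inBox hx hx'
  have h3 := hD1 x y
  have h4 := hD1 x' x
  rw [dist_comm x' x] at h4
  have hM : (0:ℝ) ≤ M := Nat.cast_nonneg M
  have h5 : (M:ℝ) * (dist j l + 2) ≤ M * (L + 2) := mul_le_mul_of_nonneg_left (by linarith) hM
  have h6 : (M:ℝ) * (dist j e + 2) ≤ M * (L + 2) := mul_le_mul_of_nonneg_left (by linarith) hM
  linarith

/-- **(5.24) + (5.25) + (5.27), ONE WALK, in norm**: if `t ≤ D` on every cube `□_{ω_i}` of the walk `ω = (ω₀; pairs)`,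
then `‖term(A)_ω − term(A+B)_ω‖ ≤ (n+1)·κ·e^{−2δ₀t}·γ₀^{−1}·Π_i αγ₀^{−1}e^{−δ₂|ω_{2i−1}−ω_{2i}|}`, `κ = 1 + γ₀^{−1}c′₀`,
`c′₀ = c₀NK_d(δ₀)` — the print's *"c′₀γ₀^{−(n+2)}αⁿ e^{−δ₂|·|}·…·(Σ_i e^{−2δ₀dist(□_{ω_{2i}},Ω^c)} + Σ_i e^{−δ₀(…)})"* with
every `dist(□,Ω^c)` replaced by the common lower bound `t` (vertex defect `h(C(A) − C(A+B))h` by (5.27); pair defect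
`−R(B)C(A)h + R(A+B)(C(A) − C(A+B))h` by (5.25), (5.15), (5.27); `‖h‖ ≤ 1`, `‖C‖ ≤ γ₀^{−1}`). [cite:
Balaban1983RegularityDecay, (5.24)–(5.27) pp.596–597] -/
theorem norm_walkTerm_sub_le (hγ : 0 < γ₀) (hc : 0 ≤ c₀) (hδ : 0 < δ₀)
    {A B : Matrix (B4.Idx Λ N) (B4.Idx Λ N) ℝ} (hA : B4.Hyp56 Λ A γ₀ c₀ δ₀)
    (hAB : B4.Hyp56 Λ (A + B) γ₀ c₀ δ₀) {D : (Fin d → ℤ) → ℝ}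
    (hB : ∀ k k' : B4.Idx Λ N, |B k k'| ≤ c₀ * Real.exp (-(δ₀ *
      (dist (k.1 : Fin d → ℤ) (k'.1 : Fin d → ℤ) + D (k.1 : Fin d → ℤ) + D (k'.1 : Fin d → ℤ)))))
    {M : ℕ} (hM : 5 ≤ M) (n : ℕ) (j : ↥(labels M Λ)) (ys : Fin n → ↥(labels M Λ) × ↥(labels M Λ)) {t : ℝ}
    (htj : ∀ y : ↥Λ, InBox M j.1 (y : Fin d → ℤ) → t ≤ D y)
    (ht1 : ∀ k (y : ↥Λ), InBox M (ys k).1.1 (y : Fin d → ℤ) → t ≤ D y)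
    (ht2 : ∀ k (y : ↥Λ), InBox M (ys k).2.1 (y : Fin d → ℤ) → t ≤ D y) :
    ‖walkTerm517 (aFac (hFam N M Λ) (cFam M A)) (bFac A (pFam N M Λ) (hFam N M Λ) (cFam M A)) ⟨n, j, ys⟩ -
      walkTerm517 (aFac (hFam N M Λ) (cFam M (A + B)))
        (bFac (A + B) (pFam N M Λ) (hFam N M Λ) (cFam M (A + B))) ⟨n, j, ys⟩‖ ≤
      (n + 1) * (1 + γ₀⁻¹ * (c₀ * (N * latticeConst d δ₀))) * Real.exp (-(2 * δ₀ * t)) * γ₀⁻¹ *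
        ∏ i, (alpha515 d N c₀ δ₀ M *
          Real.exp (-(δ₀ / 4 * dist ((ys i).1.1 : Fin d → ℤ) ((ys i).2.1 : Fin d → ℤ))) * γ₀⁻¹) := by
  set p := pFam N M Λ with hp
  set h := hFam N M Λ with hh
  set cB := c₀ * (N * latticeConst d δ₀) with hcB
  set Ξ₀ := Real.exp (-(2 * δ₀ * t)) with hΞ₀
  set κ := 1 + γ₀⁻¹ * cB with hκ
  set β : ↥(labels M Λ) × ↥(labels M Λ) → ℝ := fun q => alpha515 d N c₀ δ₀ M *
    Real.exp (-(δ₀ / 4 * dist (q.1.1 : Fin d → ℤ) (q.2.1 : Fin d → ℤ))) * γ₀⁻¹ with hβ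
  have hα := alpha515_nonneg d N hc hδ M
  have hK := latticeConst_nonneg d hδ.le
  have hcB0 : 0 ≤ cB := by positivity
  have hκ0 : 0 ≤ κ := by positivity
  have hΞ00 : 0 ≤ Ξ₀ := (Real.exp_pos _).le
  have hβb : ∀ q, ‖bFac A p h (cFam M A) q‖ ≤ β q := fun q => l2norm_bFac_le hγ hc hδ hA hM q
  have hβb' : ∀ q, ‖bFac (A + B) p h (cFam M (A + B)) q‖ ≤ β q := fun q => l2norm_bFac_le hγ hc hδ hAB hM q
  have hh1 : ∀ l : ↥(labels M Λ), ‖h l‖ ≤ 1 := fun l => l2norm_hFam_le (N := N) M l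
  have hC : ∀ l : ↥(labels M Λ), ‖cFam M A l‖ ≤ γ₀⁻¹ := fun l => l2norm_cFam_le hγ hc hδ hA M l
  have hCd : ∀ l : ↥(labels M Λ), (∀ y : ↥Λ, InBox M l.1 (y : Fin d → ℤ) → t ≤ D y) →
      ‖cFam M A l - cFam M (A + B) l‖ ≤ γ₀⁻¹ * γ₀⁻¹ * (c₀ * Ξ₀ * (N * latticeConst d δ₀)) :=
    fun l hl => l2norm_cOp_sub_cOp_le hγ hc hδ hA hAB hB M l.1 hl
  -- the pair defects
  have hd : ∀ k, ‖bFac A p h (cFam M A) (ys k) - bFac (A + B) p h (cFam M (A + B)) (ys k)‖ ≤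
      (κ * Ξ₀) * β (ys k) := by
    intro k
    set q := ys k with hq
    have e : bFac A p h (cFam M A) q - bFac (A + B) p h (cFam M (A + B)) q =
        (rPair A p h q.1 q.2 - rPair (A + B) p h q.1 q.2) * cFam M A q.2 * h q.2 +
          rPair (A + B) p h q.1 q.2 * (cFam M A q.2 - cFam M (A + B) q.2) * h q.2 := by
      simp only [bFac]; noncomm_ring
    rw [e, rPair_sub_rPair_add]
    have h1 := l2norm_rPair_pert_le hM hc hδ hB q.1 q.2 (ht1 k) (ht2 k)
    have e1 : Real.exp (-(δ₀ * (t + t))) = Ξ₀ := by rw [hΞ₀]; congr 1; ring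
    rw [e1] at h1
    have h4 := l2norm_rPair_le hM hc hδ hAB.2.2 q.1 q.2
    have h5 := hCd q.2 (ht2 k)
    have h0 : 0 ≤ alpha515 d N c₀ δ₀ M *
        Real.exp (-(δ₀ / 4 * dist (q.1.1 : Fin d → ℤ) (q.2.1 : Fin d → ℤ))) := by positivity
    calc ‖-rPair B p h q.1 q.2 * cFam M A q.2 * h q.2 +
          rPair (A + B) p h q.1 q.2 * (cFam M A q.2 - cFam M (A + B) q.2) * h q.2‖
        ≤ ‖-rPair B p h q.1 q.2 * cFam M A q.2 * h q.2‖ +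
          ‖rPair (A + B) p h q.1 q.2 * (cFam M A q.2 - cFam M (A + B) q.2) * h q.2‖ := norm_add_le _ _
      _ ≤ ‖rPair B p h q.1 q.2‖ * ‖cFam M A q.2‖ * ‖h q.2‖ +
          ‖rPair (A + B) p h q.1 q.2‖ * ‖cFam M A q.2 - cFam M (A + B) q.2‖ * ‖h q.2‖ := by
          refine add_le_add ?_ norm_mul₃_le
          rw [neg_mul, neg_mul, norm_neg]; exact norm_mul₃_le
      _ ≤ (alpha515 d N c₀ δ₀ M * Real.exp (-(δ₀ / 4 * dist (q.1.1 : Fin d → ℤ) (q.2.1 : Fin d → ℤ))) * Ξ₀) *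
            γ₀⁻¹ * 1 +
          (alpha515 d N c₀ δ₀ M * Real.exp (-(δ₀ / 4 * dist (q.1.1 : Fin d → ℤ) (q.2.1 : Fin d → ℤ)))) *
            (γ₀⁻¹ * γ₀⁻¹ * (c₀ * Ξ₀ * (N * latticeConst d δ₀))) * 1 := by
          refine add_le_add ?_ ?_
          · exact mul_le_mul (mul_le_mul h1 (hC q.2) (norm_nonneg _) (by positivity)) (hh1 q.2)
              (norm_nonneg _) (by positivity)
          · exact mul_le_mul (mul_le_mul h4 h5 (norm_nonneg _) h0) (hh1 q.2) (norm_nonneg _) (by positivity)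
      _ = (κ * Ξ₀) * β q := by rw [hκ, hβ, hcB]; ring
  -- the vertex defect
  have hda : ‖aFac h (cFam M A) j - aFac h (cFam M (A + B)) j‖ ≤
      γ₀⁻¹ * γ₀⁻¹ * (c₀ * Ξ₀ * (N * latticeConst d δ₀)) := by
    have e : aFac h (cFam M A) j - aFac h (cFam M (A + B)) j = h j * (cFam M A j - cFam M (A + B) j) * h j := by
      simp only [aFac]; noncomm_ring
    rw [e]
    calc ‖h j * (cFam M A j - cFam M (A + B) j) * h j‖
        ≤ ‖h j‖ * ‖cFam M A j - cFam M (A + B) j‖ * ‖h j‖ := norm_mul₃_le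
      _ ≤ 1 * (γ₀⁻¹ * γ₀⁻¹ * (c₀ * Ξ₀ * (N * latticeConst d δ₀))) * 1 :=
          mul_le_mul (mul_le_mul (hh1 j) (hCd j htj) (norm_nonneg _) zero_le_one) (hh1 j) (norm_nonneg _)
            (by positivity)
      _ = _ := by ring
  have ha' : ‖aFac h (cFam M (A + B)) j‖ ≤ γ₀⁻¹ := l2norm_aFac_le hγ hc hδ hAB M j
  have htel := norm_mul_bprod_sub_le (b := bFac A p h (cFam M A)) (b' := bFac (A + B) p h (cFam M (A + B)))
    (β := β) (η := κ * Ξ₀) (by positivity) hβb hβb' n (aFac h (cFam M A) j) (aFac h (cFam M (A + B)) j) ys hd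
  have hP : 0 ≤ ∏ i, β (ys i) := Finset.prod_nonneg fun i _ => (norm_nonneg _).trans (hβb _)
  refine htel.trans (mul_le_mul_of_nonneg_right ?_ hP)
  have h6 : γ₀⁻¹ * γ₀⁻¹ * (c₀ * Ξ₀ * (N * latticeConst d δ₀)) ≤ κ * Ξ₀ * γ₀⁻¹ := by
    rw [show γ₀⁻¹ * γ₀⁻¹ * (c₀ * Ξ₀ * (N * latticeConst d δ₀)) = (γ₀⁻¹ * cB) * Ξ₀ * γ₀⁻¹ by rw [hcB]; ring]
    exact mul_le_mul_of_nonneg_right (mul_le_mul_of_nonneg_right (by rw [hκ]; linarith) hΞ00)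
      (inv_nonneg.mpr hγ.le)
  have h7 : (n : ℝ) * (κ * Ξ₀) * ‖aFac h (cFam M (A + B)) j‖ ≤ n * (κ * Ξ₀) * γ₀⁻¹ :=
    mul_le_mul_of_nonneg_left ha' (by positivity)
  calc ‖aFac h (cFam M A) j - aFac h (cFam M (A + B)) j‖ + n * (κ * Ξ₀) * ‖aFac h (cFam M (A + B)) j‖
      ≤ κ * Ξ₀ * γ₀⁻¹ + n * (κ * Ξ₀) * γ₀⁻¹ := add_le_add (hda.trans h6) h7
    _ = (n + 1) * κ * Ξ₀ * γ₀⁻¹ := by ring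

/-- **ONE WALK, ENTRYWISE** — the summand of p. 597's *"Σ_{ω: x∈□_{ω₀}, x′∈□_{ω_{2n}}} c′₀γ₀^{−(n+2)}αⁿ(e^{dδ₂})ⁿ
e^{−δ₂|ω₀−ω₁|}·…·(Σ_i e^{−2δ₀dist(□_{ω_{2i}},Ω^c)} + …)"* with the boundary factors already exchanged for
`e^{−(δ₀/(48M))(D(x) + D(x′))}` and the end label for `e^{−(δ₀/(16M))|x−x′|}` (as (5.21)): for a walk `ω = (ω₀; pairs)`
obeying (5.17), `|term(A)_ω(x,x′) − term(A+B)_ω(x,x′)| ≤ 1[x ∈ □_{ω₀}]·e^{δ₀/8}e^{−(δ₀/(16M))|x−x′|}·(n+1)κγ₀^{−1}e^{δ₀/8}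
e^{−(δ₀/(48M))(D(x)+D(x′))}·e^{(δ₀/16)|ω₀−ω_{2n}|}·Π_i e^{(δ₀/16)(1+|ω_{2i−1}−ω_{2i}|)}αγ₀^{−1}e^{−δ₂|ω_{2i−1}−ω_{2i}|}`.
[cite: Balaban1983RegularityDecay, p.597 (display after (5.27))] -/
theorem abs_walkTerm_sub_apply_le (hγ : 0 < γ₀) (hc : 0 ≤ c₀) (hδ : 0 < δ₀)
    {A B : Matrix (B4.Idx Λ N) (B4.Idx Λ N) ℝ} (hA : B4.Hyp56 Λ A γ₀ c₀ δ₀)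
    (hAB : B4.Hyp56 Λ (A + B) γ₀ c₀ δ₀) {D : (Fin d → ℤ) → ℝ} (hD0 : ∀ y, 0 ≤ D y)
    (hD1 : ∀ y z : Fin d → ℤ, D y ≤ D z + dist y z)
    (hB : ∀ k k' : B4.Idx Λ N, |B k k'| ≤ c₀ * Real.exp (-(δ₀ *
      (dist (k.1 : Fin d → ℤ) (k'.1 : Fin d → ℤ) + D (k.1 : Fin d → ℤ) + D (k'.1 : Fin d → ℤ)))))
    {M : ℕ} (hM : 5 ≤ M) (n : ℕ) (j : ↥(labels M Λ)) (ys : Fin n → ↥(labels M Λ) × ↥(labels M Λ))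
    (hw : IsWalk (fun q q' : ↥(labels M Λ) × ↥(labels M Λ) => Adj q.2.1 q'.1.1) (j, j) ys)
    (x x' : B4.Idx Λ N) :
    |walkTerm517 (aFac (hFam N M Λ) (cFam M A)) (bFac A (pFam N M Λ) (hFam N M Λ) (cFam M A)) ⟨n, j, ys⟩ x x' -
      walkTerm517 (aFac (hFam N M Λ) (cFam M (A + B)))
        (bFac (A + B) (pFam N M Λ) (hFam N M Λ) (cFam M (A + B))) ⟨n, j, ys⟩ x x'| ≤
      (if InBox M j.1 (x.1 : Fin d → ℤ) then 1 else 0) *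
        (Real.exp (δ₀ / 8) * Real.exp (-(δ₀ / (16 * M) * dist (x.1 : Fin d → ℤ) (x'.1 : Fin d → ℤ)))) *
        ((n + 1) * (1 + γ₀⁻¹ * (c₀ * (N * latticeConst d δ₀))) * γ₀⁻¹ * Real.exp (δ₀ / 8) *
          Real.exp (-(δ₀ / (48 * M) * (D (x.1 : Fin d → ℤ) + D (x'.1 : Fin d → ℤ))))) *
        (Real.exp (δ₀ / 16 * dist (j.1 : Fin d → ℤ) ((lastPt j n (fun i => (ys i).2)).1 : Fin d → ℤ)) *
          ∏ i, (Real.exp (δ₀ / 16 * (1 + dist ((ys i).1.1 : Fin d → ℤ) ((ys i).2.1 : Fin d → ℤ))) *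
            (alpha515 d N c₀ δ₀ M *
              Real.exp (-(δ₀ / 4 * dist ((ys i).1.1 : Fin d → ℤ) ((ys i).2.1 : Fin d → ℤ))) * γ₀⁻¹))) := by
  have hM0 : 0 < M := by omega
  have hMr : (0:ℝ) < M := by exact_mod_cast hM0
  have hα := alpha515_nonneg d N hc hδ M
  have hK := latticeConst_nonneg d hδ.le
  set T := walkTerm517 (aFac (hFam N M Λ) (cFam M A)) (bFac A (pFam N M Λ) (hFam N M Λ) (cFam M A))
    ⟨n, j, ys⟩ with hT
  set T' := walkTerm517 (aFac (hFam N M Λ) (cFam M (A + B)))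
    (bFac (A + B) (pFam N M Λ) (hFam N M Λ) (cFam M (A + B))) ⟨n, j, ys⟩ with hT'
  by_cases hz : T x x' - T' x x' = 0
  · rw [hz, abs_zero]; positivity
  · have hxj : hfun M j.1 (x.1 : Fin d → ℤ) ≠ 0 := by
      intro h0
      apply hz
      rw [hT, hT', walkTerm_apply_eq_zero_left A ⟨n, j, ys⟩ x x' h0,
        walkTerm_apply_eq_zero_left (A + B) ⟨n, j, ys⟩ x x' h0, sub_zero]
    have hx'e : hfun M (lastPt j n (fun i => (ys i).2)).1 (x'.1 : Fin d → ℤ) ≠ 0 := by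
      intro h0
      apply hz
      rw [hT, hT', walkTerm_apply_eq_zero_right A ⟨n, j, ys⟩ x x' h0,
        walkTerm_apply_eq_zero_right (A + B) ⟨n, j, ys⟩ x x' h0, sub_zero]
    have hxB := inBox_of_hfun_ne_zero hM0 hxj
    have hx'B := inBox_of_hfun_ne_zero hM0 hx'e
    rw [if_pos hxB, one_mul]
    -- walk geometry
    set L := ∑ k, (1 + dist ((ys k).1.1 : Fin d → ℤ) ((ys k).2.1 : Fin d → ℤ)) with hL
    have hL0 : 0 ≤ L := Finset.sum_nonneg fun k _ => by positivity
    have hlab := walk_label_dist_le (fun l l' : ↥(labels M Λ) => Adj l.1 l'.1)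
      (fun l l' : ↥(labels M Λ) => dist (l.1 : Fin d → ℤ) (l'.1 : Fin d → ℤ)) (fun _ _ => dist_nonneg)
      (fun _ _ _ => dist_triangle _ _ _) (fun _ _ h => dist_le_one_of_adj h) n (j, j) ys hw
    have hlast := walk_lastPt_dist_le (fun l l' : ↥(labels M Λ) => Adj l.1 l'.1)
      (fun l l' : ↥(labels M Λ) => dist (l.1 : Fin d → ℤ) (l'.1 : Fin d → ℤ)) (fun _ _ => dist_nonneg)
      (fun _ => dist_self _) (fun _ _ _ => dist_triangle _ _ _) (fun _ _ h => dist_le_one_of_adj h) n (j, j) ys hw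
    simp only at hlab hlast
    set Dx := D (x.1 : Fin d → ℤ) with hDx
    set Dx' := D (x'.1 : Fin d → ℤ) with hDx'
    set t := (Dx + Dx') / 2 - 3 / 2 * (M * (L + 2)) with ht
    set tp := max t 0 with htp
    have hyD : ∀ l : Fin d → ℤ, dist (j.1 : Fin d → ℤ) l ≤ L →
        ∀ y : ↥Λ, InBox M l (y : Fin d → ℤ) → tp ≤ D y :=
      fun l hl y hy => max_le (ref_le_D hD1 hxB hx'B hy hl hlast) (hD0 _)
    have hA' := norm_walkTerm_sub_le hγ hc hδ hA hAB hB hM n j ys (t := tp)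
      (hyD j.1 (by rw [dist_self]; exact hL0)) (fun k => hyD _ (hlab k).1) (fun k => hyD _ (hlab k).2)
    -- exponent bookkeeping: e^{−2δ₀t⁺} ≤ e^{δ₀/8}e^{−(δ₀/(48M))(D x + D x′)}e^{(δ₀/16)L}
    have hΞ : Real.exp (-(2 * δ₀ * tp)) ≤
        Real.exp (δ₀ / 8) * Real.exp (-(δ₀ / (48 * M) * (Dx + Dx'))) * Real.exp (δ₀ / 16 * L) := by
      rw [← Real.exp_add, ← Real.exp_add]
      apply Real.exp_le_exp.mpr
      have h48 : (1:ℝ) ≤ 48 * M := by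
        have : (1:ℝ) ≤ M := by exact_mod_cast hM0
        linarith
      have hδ' : δ₀ / (48 * M) ≤ δ₀ := div_le_self hδ.le h48
      have hδ'0 : 0 ≤ δ₀ / (48 * M) := by positivity
      have htp0 : 0 ≤ tp := le_max_right _ _
      have htpt : t ≤ tp := le_max_left _ _
      have h1 : -(2 * δ₀ * tp) ≤ -(2 * (δ₀ / (48 * M)) * tp) := by nlinarith
      have h2 : -(2 * (δ₀ / (48 * M)) * tp) ≤ -(2 * (δ₀ / (48 * M)) * t) := by nlinarith
      have h3 : -(2 * (δ₀ / (48 * M)) * t) = -(δ₀ / (48 * M) * (Dx + Dx')) + δ₀ / 16 * (L + 2) := by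
        rw [ht]; field_simp; ring
      linarith
    -- the end label against |x − x′| (as (5.21))
    have hexp : 1 ≤ Real.exp (δ₀ / 8) * Real.exp (-(δ₀ / (16 * M) * dist (x.1 : Fin d → ℤ) (x'.1 : Fin d → ℤ))) *
        Real.exp (δ₀ / 16 * dist (j.1 : Fin d → ℤ) ((lastPt j n (fun i => (ys i).2)).1 : Fin d → ℤ)) := by
      rw [← Real.exp_add, ← Real.exp_add]
      apply Real.one_le_exp
      set Dd := dist (x.1 : Fin d → ℤ) (x'.1 : Fin d → ℤ) with hDd
      set E := dist (j.1 : Fin d → ℤ) ((lastPt j n (fun i => (ys i).2)).1 : Fin d → ℤ) with hE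
      have hDE : Dd ≤ M * (E + 2) := dist_le_of_inBox hxB hx'B
      have h1 : δ₀ / (16 * M) * Dd ≤ δ₀ / (16 * M) * (M * (E + 2)) :=
        mul_le_mul_of_nonneg_left hDE (by positivity)
      have h2 : δ₀ / (16 * M) * (M * (E + 2)) = δ₀ / 16 * (E + 2) := by field_simp
      linarith
    have hprod : Real.exp (δ₀ / 16 * L) * ∏ i, (alpha515 d N c₀ δ₀ M *
          Real.exp (-(δ₀ / 4 * dist ((ys i).1.1 : Fin d → ℤ) ((ys i).2.1 : Fin d → ℤ))) * γ₀⁻¹) =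
        ∏ i, (Real.exp (δ₀ / 16 * (1 + dist ((ys i).1.1 : Fin d → ℤ) ((ys i).2.1 : Fin d → ℤ))) *
          (alpha515 d N c₀ δ₀ M *
            Real.exp (-(δ₀ / 4 * dist ((ys i).1.1 : Fin d → ℤ) ((ys i).2.1 : Fin d → ℤ))) * γ₀⁻¹)) := by
      rw [hL, Finset.mul_sum, Real.exp_sum, ← Finset.prod_mul_distrib]
    have hP : 0 ≤ ∏ i, (alpha515 d N c₀ δ₀ M *
        Real.exp (-(δ₀ / 4 * dist ((ys i).1.1 : Fin d → ℤ) ((ys i).2.1 : Fin d → ℤ))) * γ₀⁻¹) :=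
      Finset.prod_nonneg fun i _ => by positivity
    set κ := 1 + γ₀⁻¹ * (c₀ * (N * latticeConst d δ₀)) with hκ
    have hκ0 : 0 ≤ κ := by positivity
    have hnκ : (0:ℝ) ≤ (n + 1) * κ := by positivity
    calc |T x x' - T' x x'| = |(T - T') x x'| := by rw [Matrix.sub_apply]
      _ ≤ ‖T - T'‖ := abs_entry_le_l2norm _ x x'
      _ ≤ (n + 1) * κ * Real.exp (-(2 * δ₀ * tp)) * γ₀⁻¹ * ∏ i, (alpha515 d N c₀ δ₀ M *
            Real.exp (-(δ₀ / 4 * dist ((ys i).1.1 : Fin d → ℤ) ((ys i).2.1 : Fin d → ℤ))) * γ₀⁻¹) := hA'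
      _ ≤ (n + 1) * κ * (Real.exp (δ₀ / 8) * Real.exp (-(δ₀ / (48 * M) * (Dx + Dx'))) *
            Real.exp (δ₀ / 16 * L)) * γ₀⁻¹ * ∏ i, (alpha515 d N c₀ δ₀ M *
            Real.exp (-(δ₀ / 4 * dist ((ys i).1.1 : Fin d → ℤ) ((ys i).2.1 : Fin d → ℤ))) * γ₀⁻¹) :=
          mul_le_mul_of_nonneg_right (mul_le_mul_of_nonneg_right (mul_le_mul_of_nonneg_left hΞ hnκ)
            (inv_nonneg.mpr hγ.le)) hP
      _ = 1 * (((n + 1) * κ * γ₀⁻¹ * Real.exp (δ₀ / 8) * Real.exp (-(δ₀ / (48 * M) * (Dx + Dx')))) *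
            (Real.exp (δ₀ / 16 * L) * ∏ i, (alpha515 d N c₀ δ₀ M *
              Real.exp (-(δ₀ / 4 * dist ((ys i).1.1 : Fin d → ℤ) ((ys i).2.1 : Fin d → ℤ))) * γ₀⁻¹))) := by
          ring
      _ ≤ (Real.exp (δ₀ / 8) * Real.exp (-(δ₀ / (16 * M) * dist (x.1 : Fin d → ℤ) (x'.1 : Fin d → ℤ))) *
            Real.exp (δ₀ / 16 * dist (j.1 : Fin d → ℤ) ((lastPt j n (fun i => (ys i).2)).1 : Fin d → ℤ))) *
            (((n + 1) * κ * γ₀⁻¹ * Real.exp (δ₀ / 8) * Real.exp (-(δ₀ / (48 * M) * (Dx + Dx')))) *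
            (Real.exp (δ₀ / 16 * L) * ∏ i, (alpha515 d N c₀ δ₀ M *
              Real.exp (-(δ₀ / 4 * dist ((ys i).1.1 : Fin d → ℤ) ((ys i).2.1 : Fin d → ℤ))) * γ₀⁻¹))) :=
          mul_le_mul_of_nonneg_right hexp (by positivity)
      _ = _ := by rw [hprod]; ring

end PerWalk

/-! ## §3 Summation: the successor weight, one level `n`, the series over `n`, "we fix M", and (5.10) -/

section Main

open Literature.MathematicalPhysics.QuantumFieldTheory.Balaban1983to89
open B4Commutators25to211 B4Sect5RandomWalk B4Sect5Proof B6GOmega B4Sect5CubeBounds B4RandomWalk213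
  B4Sect5WalkDecay
open scoped Matrix.Norms.L2Operator

variable {d N : ℕ} {Λ : Finset (Fin d → ℤ)} {γ₀ c₀ δ₀ : ℝ}

/-- **THE SUCCESSOR WEIGHT** with the per-step weight `e^{(δ₀/8)(1 + |l₁ − l′|)}` split as `(δ₀/16)` for the end label
(→ `|x − x′|`) and `(δ₀/16)` for the boundary exchange: `Σ_{(l₁,l′): l ~ l₁} e^{(δ₀/16)(1+|l₁−l′|)}·
(e^{(δ₀/16)(1+|l₁−l′|)}αγ₀^{−1}e^{−δ₂|l₁−l′|}) ≤ θ_W(M) = 3^dK_d(δ₀/8)e^{δ₀/8}αγ₀^{−1}` — the constant of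
`B4Sect5WalkDecay.sum_weight_bFac_le` (the print's `γ₀^{−1}αe^{dδ₂}c₂^{2d}`). [cite: Balaban1983RegularityDecay,
(5.18)–(5.21) pp.595–596; p.597] -/
theorem sum_weight_beta_le (hγ : 0 < γ₀) (hc : 0 ≤ c₀) (hδ : 0 < δ₀) (M : ℕ) (l : ↥(labels M Λ)) :
    ∑ q ∈ Finset.univ.filter (fun q : ↥(labels M Λ) × ↥(labels M Λ) => Adj l.1 q.1.1),
      Real.exp (δ₀ / 16 * (1 + dist (q.1.1 : Fin d → ℤ) (q.2.1 : Fin d → ℤ))) *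
        (Real.exp (δ₀ / 16 * (1 + dist (q.1.1 : Fin d → ℤ) (q.2.1 : Fin d → ℤ))) *
          (alpha515 d N c₀ δ₀ M *
            Real.exp (-(δ₀ / 4 * dist (q.1.1 : Fin d → ℤ) (q.2.1 : Fin d → ℤ))) * γ₀⁻¹)) ≤
      3 ^ d * (latticeConst d (δ₀ / 8) * (Real.exp (δ₀ / 8) * alpha515 d N c₀ δ₀ M * γ₀⁻¹)) := by
  have hα := alpha515_nonneg d N hc hδ M
  have hK := latticeConst_nonneg d (by positivity : (0:ℝ) ≤ δ₀ / 8)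
  set Bc := Real.exp (δ₀ / 8) * alpha515 d N c₀ δ₀ M * γ₀⁻¹ with hBc
  have hB0 : 0 ≤ Bc := by positivity
  have hstep : ∀ q : ↥(labels M Λ) × ↥(labels M Λ),
      Real.exp (δ₀ / 16 * (1 + dist (q.1.1 : Fin d → ℤ) (q.2.1 : Fin d → ℤ))) *
        (Real.exp (δ₀ / 16 * (1 + dist (q.1.1 : Fin d → ℤ) (q.2.1 : Fin d → ℤ))) *
          (alpha515 d N c₀ δ₀ M *
            Real.exp (-(δ₀ / 4 * dist (q.1.1 : Fin d → ℤ) (q.2.1 : Fin d → ℤ))) * γ₀⁻¹)) =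
        Bc * Real.exp (-(δ₀ / 8 * dist (q.1.1 : Fin d → ℤ) (q.2.1 : Fin d → ℤ))) := by
    intro q
    set D := dist (q.1.1 : Fin d → ℤ) (q.2.1 : Fin d → ℤ) with hD
    have : Real.exp (δ₀ / 16 * (1 + D)) * Real.exp (δ₀ / 16 * (1 + D)) * Real.exp (-(δ₀ / 4 * D)) =
        Real.exp (δ₀ / 8) * Real.exp (-(δ₀ / 8 * D)) := by
      rw [← Real.exp_add, ← Real.exp_add, ← Real.exp_add]; congr 1; ring
    calc Real.exp (δ₀ / 16 * (1 + D)) * (Real.exp (δ₀ / 16 * (1 + D)) *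
          (alpha515 d N c₀ δ₀ M * Real.exp (-(δ₀ / 4 * D)) * γ₀⁻¹))
        = (Real.exp (δ₀ / 16 * (1 + D)) * Real.exp (δ₀ / 16 * (1 + D)) * Real.exp (-(δ₀ / 4 * D))) *
            alpha515 d N c₀ δ₀ M * γ₀⁻¹ := by ring
      _ = _ := by rw [this, hBc]; ring
  have hinner : ∀ j₁ : ↥(labels M Λ),
      ∑ j₂ : ↥(labels M Λ), Real.exp (-(δ₀ / 8 * dist (j₁.1 : Fin d → ℤ) (j₂.1 : Fin d → ℤ))) ≤
        latticeConst d (δ₀ / 8) := by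
    intro j₁
    rw [Finset.sum_coe_sort (labels M Λ)
      (fun j₂ => Real.exp (-(δ₀ / 8 * dist (j₁.1 : Fin d → ℤ) j₂)))]
    exact latticeSum_le d (by positivity) (labels M Λ) j₁.1
  calc ∑ q ∈ Finset.univ.filter (fun q : ↥(labels M Λ) × ↥(labels M Λ) => Adj l.1 q.1.1),
        Real.exp (δ₀ / 16 * (1 + dist (q.1.1 : Fin d → ℤ) (q.2.1 : Fin d → ℤ))) *
          (Real.exp (δ₀ / 16 * (1 + dist (q.1.1 : Fin d → ℤ) (q.2.1 : Fin d → ℤ))) *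
            (alpha515 d N c₀ δ₀ M *
              Real.exp (-(δ₀ / 4 * dist (q.1.1 : Fin d → ℤ) (q.2.1 : Fin d → ℤ))) * γ₀⁻¹))
      = ∑ q ∈ Finset.univ.filter (fun q : ↥(labels M Λ) × ↥(labels M Λ) => Adj l.1 q.1.1),
          Bc * Real.exp (-(δ₀ / 8 * dist (q.1.1 : Fin d → ℤ) (q.2.1 : Fin d → ℤ))) :=
        Finset.sum_congr rfl fun q _ => hstep q
    _ = ∑ j₁ : ↥(labels M Λ), ∑ j₂ : ↥(labels M Λ), (if Adj l.1 j₁.1 then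
          Bc * Real.exp (-(δ₀ / 8 * dist (j₁.1 : Fin d → ℤ) (j₂.1 : Fin d → ℤ))) else 0) := by
        rw [Finset.sum_filter, Fintype.sum_prod_type]
    _ ≤ ∑ j₁ : ↥(labels M Λ), (if Adj l.1 j₁.1 then Bc * latticeConst d (δ₀ / 8) else 0) := by
        refine Finset.sum_le_sum fun j₁ _ => ?_
        split_ifs with hadj
        · rw [← Finset.mul_sum]; exact mul_le_mul_of_nonneg_left (hinner j₁) hB0
        · simp
    _ = ((labels M Λ).filter fun j₁ => Adj l.1 j₁).card * (Bc * latticeConst d (δ₀ / 8)) := by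
        rw [Finset.sum_coe_sort (labels M Λ) (fun j₁ => if Adj l.1 j₁ then Bc * latticeConst d (δ₀ / 8) else 0),
          ← Finset.sum_filter, Finset.sum_const, nsmul_eq_mul]
    _ ≤ 3 ^ d * (Bc * latticeConst d (δ₀ / 8)) := by
        apply mul_le_mul_of_nonneg_right _ (by positivity)
        exact_mod_cast card_filter_adj_le (labels M Λ) l.1
    _ = 3 ^ d * (latticeConst d (δ₀ / 8) * Bc) := by ring

/-- **ONE LEVEL `n`** of p. 597's final display: `Σ_{(ω₀; pairs)} |term(A)_ω(x,x′) − term(A+B)_ω(x,x′)| ≤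
2^d·e^{δ₀/8}e^{−(δ₀/(16M))|x−x′|}·(n+1)κγ₀^{−1}e^{δ₀/8}e^{−(δ₀/(48M))(D(x)+D(x′))}·θ_W(M)ⁿ` (non-walk tuples contribute
`0` by the locality of (5.17); at most `2^d` cubes through `x`). [cite: Balaban1983RegularityDecay, p.597 (display
after (5.27)); (5.17)–(5.18) p.595] -/
theorem level_abs_sub_sum_le (hγ : 0 < γ₀) (hc : 0 ≤ c₀) (hδ : 0 < δ₀)
    {A B : Matrix (B4.Idx Λ N) (B4.Idx Λ N) ℝ} (hA : B4.Hyp56 Λ A γ₀ c₀ δ₀)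
    (hAB : B4.Hyp56 Λ (A + B) γ₀ c₀ δ₀) {D : (Fin d → ℤ) → ℝ} (hD0 : ∀ y, 0 ≤ D y)
    (hD1 : ∀ y z : Fin d → ℤ, D y ≤ D z + dist y z)
    (hB : ∀ k k' : B4.Idx Λ N, |B k k'| ≤ c₀ * Real.exp (-(δ₀ *
      (dist (k.1 : Fin d → ℤ) (k'.1 : Fin d → ℤ) + D (k.1 : Fin d → ℤ) + D (k'.1 : Fin d → ℤ)))))
    {M : ℕ} (hM : 5 ≤ M) (n : ℕ) (x x' : B4.Idx Λ N) :
    ∑ cc : ↥(labels M Λ) × (Fin n → ↥(labels M Λ) × ↥(labels M Λ)),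
      |walkTerm517 (aFac (hFam N M Λ) (cFam M A)) (bFac A (pFam N M Λ) (hFam N M Λ) (cFam M A)) ⟨n, cc⟩ x x' -
        walkTerm517 (aFac (hFam N M Λ) (cFam M (A + B)))
          (bFac (A + B) (pFam N M Λ) (hFam N M Λ) (cFam M (A + B))) ⟨n, cc⟩ x x'| ≤
      2 ^ d * (Real.exp (δ₀ / 8) * Real.exp (-(δ₀ / (16 * M) * dist (x.1 : Fin d → ℤ) (x'.1 : Fin d → ℤ)))) *
        ((n + 1) * (1 + γ₀⁻¹ * (c₀ * (N * latticeConst d δ₀))) * γ₀⁻¹ * Real.exp (δ₀ / 8) *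
          Real.exp (-(δ₀ / (48 * M) * (D (x.1 : Fin d → ℤ) + D (x'.1 : Fin d → ℤ))))) *
        (3 ^ d * (latticeConst d (δ₀ / 8) * (Real.exp (δ₀ / 8) * alpha515 d N c₀ δ₀ M * γ₀⁻¹))) ^ n := by
  have hM0 : 0 < M := by omega
  have hα := alpha515_nonneg d N hc hδ M
  have hK := latticeConst_nonneg d hδ.le
  have hK8 := latticeConst_nonneg d (by positivity : (0:ℝ) ≤ δ₀ / 8)
  set a := aFac (hFam N M Λ) (cFam M A) with ha
  set b := bFac A (pFam N M Λ) (hFam N M Λ) (cFam M A) with hb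
  set a' := aFac (hFam N M Λ) (cFam M (A + B)) with ha'
  set b' := bFac (A + B) (pFam N M Λ) (hFam N M Λ) (cFam M (A + B)) with hb'
  set θ := 3 ^ d * (latticeConst d (δ₀ / 8) * (Real.exp (δ₀ / 8) * alpha515 d N c₀ δ₀ M * γ₀⁻¹)) with hθ
  set E := Real.exp (δ₀ / 8) * Real.exp (-(δ₀ / (16 * M) * dist (x.1 : Fin d → ℤ) (x'.1 : Fin d → ℤ))) with hE
  set κ := 1 + γ₀⁻¹ * (c₀ * (N * latticeConst d δ₀)) with hκ
  set C := (n + 1) * κ * γ₀⁻¹ * Real.exp (δ₀ / 8) *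
    Real.exp (-(δ₀ / (48 * M) * (D (x.1 : Fin d → ℤ) + D (x'.1 : Fin d → ℤ)))) with hC
  set w : ↥(labels M Λ) × ↥(labels M Λ) → ℝ := fun q =>
    Real.exp (δ₀ / 16 * (1 + dist (q.1.1 : Fin d → ℤ) (q.2.1 : Fin d → ℤ))) *
      (alpha515 d N c₀ δ₀ M * Real.exp (-(δ₀ / 4 * dist (q.1.1 : Fin d → ℤ) (q.2.1 : Fin d → ℤ))) * γ₀⁻¹)
    with hw
  have hw0 : ∀ q, 0 ≤ w q := fun q => by rw [hw]; positivity
  have hκ0 : 0 ≤ κ := by positivity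
  have hE0 : 0 ≤ E := by positivity
  have hC0 : 0 ≤ C := by positivity
  have hθ0 : 0 ≤ θ := by positivity
  have hj : ∀ j : ↥(labels M Λ), ∑ ys : Fin n → ↥(labels M Λ) × ↥(labels M Λ),
      |walkTerm517 a b ⟨n, j, ys⟩ x x' - walkTerm517 a' b' ⟨n, j, ys⟩ x x'| ≤
      ((if InBox M j.1 (x.1 : Fin d → ℤ) then 1 else 0) * E * C) * θ ^ n := by
    intro j
    have hind : (0:ℝ) ≤ (if InBox M j.1 (x.1 : Fin d → ℤ) then 1 else 0) * E * C := by positivity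
    refine level_walk_sum_le (fun l l' : ↥(labels M Λ) => Adj l.1 l'.1)
      (fun l l' : ↥(labels M Λ) => dist (l.1 : Fin d → ℤ) (l'.1 : Fin d → ℤ)) (fun _ => dist_self _)
      (fun _ _ _ => dist_triangle _ _ _) (fun _ _ h => dist_le_one_of_adj h) hw0
      (by positivity : (0:ℝ) ≤ δ₀ / 16) (sum_weight_beta_le hγ hc hδ M) n (j, j)
      (fun ys => |walkTerm517 a b ⟨n, j, ys⟩ x x' - walkTerm517 a' b' ⟨n, j, ys⟩ x x'|) _ hind
      (fun ys hys => ?_) (fun ys hys => ?_)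
    · exact abs_walkTerm_sub_apply_le hγ hc hδ hA hAB hD0 hD1 hB hM n j ys hys x x'
    · have hz1 : a j * bprod b n ys = 0 :=
        mul_bprod_eq_zero_of_not_isWalk (adj := fun q q' : ↥(labels M Λ) × ↥(labels M Λ) => Adj q.2.1 q'.1.1)
          (fun q q' hq => bFac_mul_bFac_eq_zero hM0 A q q' hq) n
          (fun l hl => aFac_mul_bFac_eq_zero hM0 A j l hl) hys
      have hz2 : a' j * bprod b' n ys = 0 :=
        mul_bprod_eq_zero_of_not_isWalk (adj := fun q q' : ↥(labels M Λ) × ↥(labels M Λ) => Adj q.2.1 q'.1.1)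
          (fun q q' hq => bFac_mul_bFac_eq_zero hM0 (A + B) q q' hq) n
          (fun l hl => aFac_mul_bFac_eq_zero hM0 (A + B) j l hl) hys
      change |(a j * bprod b n ys) x x' - (a' j * bprod b' n ys) x x'| ≤ 0
      rw [hz1, hz2]
      simp
  calc ∑ cc : ↥(labels M Λ) × (Fin n → ↥(labels M Λ) × ↥(labels M Λ)),
        |walkTerm517 a b ⟨n, cc⟩ x x' - walkTerm517 a' b' ⟨n, cc⟩ x x'|
      = ∑ j : ↥(labels M Λ), ∑ ys : Fin n → ↥(labels M Λ) × ↥(labels M Λ),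
          |walkTerm517 a b ⟨n, j, ys⟩ x x' - walkTerm517 a' b' ⟨n, j, ys⟩ x x'| := Fintype.sum_prod_type _
    _ ≤ ∑ j : ↥(labels M Λ), ((if InBox M j.1 (x.1 : Fin d → ℤ) then 1 else 0) * E * C) * θ ^ n :=
        Finset.sum_le_sum fun j _ => hj j
    _ = (∑ j : ↥(labels M Λ), (if InBox M j.1 (x.1 : Fin d → ℤ) then (1 : ℝ) else 0)) * (E * C * θ ^ n) := by
        rw [Finset.sum_mul]; refine Finset.sum_congr rfl fun j _ => ?_; ring
    _ ≤ 2 ^ d * (E * C * θ ^ n) := mul_le_mul_of_nonneg_right (sum_indicator_inBox_le hM0 _) (by positivity)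
    _ = 2 ^ d * E * C * θ ^ n := by ring

/-- the difference (5.24) of the two walk expansions (5.17), read ENTRYWISE as one `HasSum`. [cite:
Balaban1983RegularityDecay, (5.24) p.596] -/
theorem hasSum_walkTerm_sub_apply (hγ : 0 < γ₀) (hc : 0 ≤ c₀) (hδ : 0 < δ₀)
    {A B : Matrix (B4.Idx Λ N) (B4.Idx Λ N) ℝ} (hA : B4.Hyp56 Λ A γ₀ c₀ δ₀)
    (hAB : B4.Hyp56 Λ (A + B) γ₀ c₀ δ₀) {M : ℕ} (hM : 5 ≤ M) (hMR : kR d N γ₀ c₀ δ₀ < M)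
    (hMθ : thetaConst d N γ₀ c₀ δ₀ < M) (x x' : B4.Idx Λ N) :
    HasSum (fun ω => walkTerm517 (aFac (hFam N M Λ) (cFam M A))
        (bFac A (pFam N M Λ) (hFam N M Λ) (cFam M A)) ω x x' -
      walkTerm517 (aFac (hFam N M Λ) (cFam M (A + B)))
        (bFac (A + B) (pFam N M Λ) (hFam N M Λ) (cFam M (A + B))) ω x x') (A⁻¹ x x' - (A + B)⁻¹ x x') :=
  (hasSum_walkTerm_apply hγ hc hδ hA hM hMR hMθ x x').sub (hasSum_walkTerm_apply hγ hc hδ hAB hM hMR hMθ x x')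

/-- **(5.10) FOR A FIXED CUBE SIZE** p. 597 [PDF 27], the final display, verbatim: *"The equality (5.24) and the above
estimates imply |A_Λ^{−1}(x,x′) − (A+B)_Λ^{−1}(x,x′)| ≤ … ≤ e^{−⅓δ₂M^{−1}(dist(x,Ω^c) + dist(x′,Ω^c))}γ₀^{−2}c′₀e^{2dδ₂}
(1 − γ₀^{−1}4e^{dδ₂}c₂^{2d}α)^{−1}e^{−⅓δ₂M^{−1}|x−x′|}. Thus Inequality (5.10) is proved."* — typed: for `M ≥ 5`, `M > K_R`,
`M > Θ₁` (both expansions converge) and `2θ_W(M) < 1`,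
`|A_Λ^{−1}(x,x′) − (A+B)_Λ^{−1}(x,x′)| ≤ 2^dκγ₀^{−1}e^{δ₀/4}(1 − 2θ_W)^{−1}e^{−(δ₀/(48M))(|x−x′| + D(x) + D(x′))}`,
`κ = 1 + γ₀^{−1}c₀NK_d(δ₀)` (`(n+1)θ_Wⁿ ≤ (2θ_W)ⁿ` = the print's *"4e^{dδ₂}c₂^{2d}α"*). [cite: Balaban1983RegularityDecay,
(5.10) p.594; p.597] -/
theorem abs_inv_sub_inv_apply_le_of_walk (hγ : 0 < γ₀) (hc : 0 ≤ c₀) (hδ : 0 < δ₀)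
    {A B : Matrix (B4.Idx Λ N) (B4.Idx Λ N) ℝ} (hA : B4.Hyp56 Λ A γ₀ c₀ δ₀)
    (hAB : B4.Hyp56 Λ (A + B) γ₀ c₀ δ₀) {D : (Fin d → ℤ) → ℝ} (hD0 : ∀ y, 0 ≤ D y)
    (hD1 : ∀ y z : Fin d → ℤ, D y ≤ D z + dist y z)
    (hB : ∀ k k' : B4.Idx Λ N, |B k k'| ≤ c₀ * Real.exp (-(δ₀ *
      (dist (k.1 : Fin d → ℤ) (k'.1 : Fin d → ℤ) + D (k.1 : Fin d → ℤ) + D (k'.1 : Fin d → ℤ)))))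
    {M : ℕ} (hM : 5 ≤ M) (hMR : kR d N γ₀ c₀ δ₀ < M) (hMθ : thetaConst d N γ₀ c₀ δ₀ < M)
    (hθW : 2 * (3 ^ d * (latticeConst d (δ₀ / 8) * (Real.exp (δ₀ / 8) * alpha515 d N c₀ δ₀ M * γ₀⁻¹))) < 1)
    (x x' : B4.Idx Λ N) :
    |A⁻¹ x x' - (A + B)⁻¹ x x'| ≤
      2 ^ d * (1 + γ₀⁻¹ * (c₀ * (N * latticeConst d δ₀))) * γ₀⁻¹ * Real.exp (δ₀ / 4) *
        (1 - 2 * (3 ^ d * (latticeConst d (δ₀ / 8) * (Real.exp (δ₀ / 8) * alpha515 d N c₀ δ₀ M * γ₀⁻¹))))⁻¹ *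
        Real.exp (-(δ₀ / (48 * M) *
          (dist (x.1 : Fin d → ℤ) (x'.1 : Fin d → ℤ) + D (x.1 : Fin d → ℤ) + D (x'.1 : Fin d → ℤ)))) := by
  have hα := alpha515_nonneg d N hc hδ M
  have hK := latticeConst_nonneg d hδ.le
  have hK8 := latticeConst_nonneg d (by positivity : (0:ℝ) ≤ δ₀ / 8)
  set θ := 3 ^ d * (latticeConst d (δ₀ / 8) * (Real.exp (δ₀ / 8) * alpha515 d N c₀ δ₀ M * γ₀⁻¹)) with hθ
  set κ := 1 + γ₀⁻¹ * (c₀ * (N * latticeConst d δ₀)) with hκ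
  have hθ0 : 0 ≤ θ := by positivity
  have hκ0 : 0 ≤ κ := by positivity
  have h2θ0 : 0 ≤ 2 * θ := by positivity
  set f := fun ω => walkTerm517 (aFac (hFam N M Λ) (cFam M A))
        (bFac A (pFam N M Λ) (hFam N M Λ) (cFam M A)) ω x x' -
      walkTerm517 (aFac (hFam N M Λ) (cFam M (A + B)))
        (bFac (A + B) (pFam N M Λ) (hFam N M Λ) (cFam M (A + B))) ω x x' with hf
  have hsum : HasSum f (A⁻¹ x x' - (A + B)⁻¹ x x') := hasSum_walkTerm_sub_apply hγ hc hδ hA hAB hM hMR hMθ x x'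
  have habs : Summable fun ω => |f ω| := hsum.summable.abs
  have h1 : |A⁻¹ x x' - (A + B)⁻¹ x x'| ≤ ∑' ω, |f ω| := by
    have habs' : Summable fun ω => ‖f ω‖ := by simpa only [Real.norm_eq_abs] using habs
    have h := norm_tsum_le_tsum_norm habs'
    rw [hsum.tsum_eq] at h
    simpa only [Real.norm_eq_abs] using h
  have h2 : ∑' ω, |f ω| = ∑' n, ∑' cc, |f ⟨n, cc⟩| :=
    Summable.tsum_sigma' (fun n => (hasSum_fintype _).summable) habs
  set Cx := 2 ^ d * (Real.exp (δ₀ / 8) * Real.exp (-(δ₀ / (16 * M) * dist (x.1 : Fin d → ℤ) (x'.1 : Fin d → ℤ)))) *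
    (κ * γ₀⁻¹ * Real.exp (δ₀ / 8) *
      Real.exp (-(δ₀ / (48 * M) * (D (x.1 : Fin d → ℤ) + D (x'.1 : Fin d → ℤ))))) with hCx
  have hCx0 : 0 ≤ Cx := by positivity
  have h3 : ∀ n, ∑' cc, |f ⟨n, cc⟩| ≤ Cx * (2 * θ) ^ n := fun n => by
    rw [tsum_fintype]
    have hlev := level_abs_sub_sum_le hγ hc hδ hA hAB hD0 hD1 hB hM n x x'
    rw [← hθ, ← hκ] at hlev
    refine hlev.trans ?_
    have hn : (n : ℝ) + 1 ≤ (2 : ℝ) ^ n := by exact_mod_cast Nat.succ_le_of_lt Nat.lt_two_pow_self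
    calc 2 ^ d * (Real.exp (δ₀ / 8) * Real.exp (-(δ₀ / (16 * M) * dist (x.1 : Fin d → ℤ) (x'.1 : Fin d → ℤ)))) *
          ((n + 1) * κ * γ₀⁻¹ * Real.exp (δ₀ / 8) *
            Real.exp (-(δ₀ / (48 * M) * (D (x.1 : Fin d → ℤ) + D (x'.1 : Fin d → ℤ))))) * θ ^ n
        = (n + 1) * (Cx * θ ^ n) := by rw [hCx]; ring
      _ ≤ 2 ^ n * (Cx * θ ^ n) := mul_le_mul_of_nonneg_right hn (by positivity)
      _ = Cx * (2 * θ) ^ n := by rw [mul_pow]; ring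
  have h4 : Summable fun n => ∑' cc, |f ⟨n, cc⟩| := habs.sigma
  have h5 : ∑' n, ∑' cc, |f ⟨n, cc⟩| ≤ ∑' n : ℕ, Cx * (2 * θ) ^ n :=
    Summable.tsum_le_tsum h3 h4 ((summable_geometric_of_lt_one h2θ0 hθW).mul_left Cx)
  have h6 : ∑' n : ℕ, Cx * (2 * θ) ^ n = Cx * (1 - 2 * θ)⁻¹ := by
    rw [tsum_mul_left, tsum_geometric_of_lt_one h2θ0 hθW]
  have hinv0 : 0 ≤ (1 - 2 * θ)⁻¹ := inv_nonneg.mpr (by linarith)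
  have hdist : Real.exp (-(δ₀ / (16 * M) * dist (x.1 : Fin d → ℤ) (x'.1 : Fin d → ℤ))) ≤
      Real.exp (-(δ₀ / (48 * M) * dist (x.1 : Fin d → ℤ) (x'.1 : Fin d → ℤ))) := by
    apply Real.exp_le_exp.mpr
    have hM0' : 0 < M := by omega
    have hMr : (0:ℝ) < M := by exact_mod_cast hM0'
    have hd0 : 0 ≤ dist (x.1 : Fin d → ℤ) (x'.1 : Fin d → ℤ) := dist_nonneg
    have h16 : δ₀ / (48 * M) ≤ δ₀ / (16 * M) :=
      div_le_div_of_nonneg_left hδ.le (by positivity) (by linarith)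
    have := mul_le_mul_of_nonneg_right h16 hd0
    linarith
  have e1 : Real.exp (δ₀ / 4) = Real.exp (δ₀ / 8) * Real.exp (δ₀ / 8) := by
    rw [← Real.exp_add]; congr 1; ring
  have e2 : Real.exp (-(δ₀ / (48 * M) *
        (dist (x.1 : Fin d → ℤ) (x'.1 : Fin d → ℤ) + D (x.1 : Fin d → ℤ) + D (x'.1 : Fin d → ℤ)))) =
      Real.exp (-(δ₀ / (48 * M) * (D (x.1 : Fin d → ℤ) + D (x'.1 : Fin d → ℤ)))) *
        Real.exp (-(δ₀ / (48 * M) * dist (x.1 : Fin d → ℤ) (x'.1 : Fin d → ℤ))) := by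
    rw [← Real.exp_add]; congr 1; ring
  calc |A⁻¹ x x' - (A + B)⁻¹ x x'| ≤ ∑' n, ∑' cc, |f ⟨n, cc⟩| := h1.trans_eq h2
    _ ≤ Cx * (1 - 2 * θ)⁻¹ := h5.trans_eq h6
    _ = (2 ^ d * κ * γ₀⁻¹ * (Real.exp (δ₀ / 8) * Real.exp (δ₀ / 8)) * (1 - 2 * θ)⁻¹ *
          Real.exp (-(δ₀ / (48 * M) * (D (x.1 : Fin d → ℤ) + D (x'.1 : Fin d → ℤ))))) *
          Real.exp (-(δ₀ / (16 * M) * dist (x.1 : Fin d → ℤ) (x'.1 : Fin d → ℤ))) := by rw [hCx]; ring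
    _ ≤ (2 ^ d * κ * γ₀⁻¹ * (Real.exp (δ₀ / 8) * Real.exp (δ₀ / 8)) * (1 - 2 * θ)⁻¹ *
          Real.exp (-(δ₀ / (48 * M) * (D (x.1 : Fin d → ℤ) + D (x'.1 : Fin d → ℤ))))) *
          Real.exp (-(δ₀ / (48 * M) * dist (x.1 : Fin d → ℤ) (x'.1 : Fin d → ℤ))) :=
        mul_le_mul_of_nonneg_left hdist (by positivity)
    _ = _ := by rw [e1, e2]; ring

/-- *"α depending on M and arbitrarily small if M is sufficiently large"* ⇒ the cube size can be FIXED depending on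
`d, N, γ₀, c₀, δ₀` only, and then **(5.10) holds with `c₁ = 2^{d+1}κγ₀^{−1}e^{δ₀/4}`, `δ₁ = δ₀/(48M)`** — p. 597: *"The
constants δ₁, c₁ are functions of δ₀, γ₀, c₀"* — for EVERY finite `Λ ⊂ ℤ^d`, all `A`, `A + B` with (5.6) on `L²(Λ; ℝ^N)`
and every `B` with `|B(x,x′)| ≤ c₀e^{−δ₀(|x−x′| + D(x) + D(x′))}`, `D ≥ 0` 1-Lipschitz (e.g. `D = dist(·,Ω^c)`, (5.9)).
[cite: Balaban1983RegularityDecay, (5.10) p.594; p.596 "we fix M"; p.597] -/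
theorem concl510_walk (d N : ℕ) (hγ : 0 < γ₀) (hc : 0 ≤ c₀) (hδ : 0 < δ₀) :
    ∃ M : ℕ, 0 < M ∧ ∀ (Λ : Finset (Fin d → ℤ)) (A B : Matrix (B4.Idx Λ N) (B4.Idx Λ N) ℝ)
      (D : (Fin d → ℤ) → ℝ), B4.Hyp56 Λ A γ₀ c₀ δ₀ → B4.Hyp56 Λ (A + B) γ₀ c₀ δ₀ → (∀ y, 0 ≤ D y) →
      (∀ y z : Fin d → ℤ, D y ≤ D z + dist y z) →
      (∀ k k' : B4.Idx Λ N, |B k k'| ≤ c₀ * Real.exp (-(δ₀ *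
        (dist (k.1 : Fin d → ℤ) (k'.1 : Fin d → ℤ) + D (k.1 : Fin d → ℤ) + D (k'.1 : Fin d → ℤ))))) →
      ∀ x x' : B4.Idx Λ N, |A⁻¹ x x' - (A + B)⁻¹ x x'| ≤
        2 ^ (d + 1) * (1 + γ₀⁻¹ * (c₀ * (N * latticeConst d δ₀))) * γ₀⁻¹ * Real.exp (δ₀ / 4) *
          Real.exp (-(δ₀ / (48 * M) *
            (dist (x.1 : Fin d → ℤ) (x'.1 : Fin d → ℤ) + D (x.1 : Fin d → ℤ) + D (x'.1 : Fin d → ℤ)))) := by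
  have hK := latticeConst_nonneg d hδ.le
  have hK8 := latticeConst_nonneg d (by positivity : (0:ℝ) ≤ δ₀ / 8)
  set Θ := 3 ^ d * (latticeConst d (δ₀ / 8) * (Real.exp (δ₀ / 8) * γ₀⁻¹ *
    (3 * Real.pi * d / 2 * weightConst d N c₀ δ₀ + c₀ * (N * latticeConst d (δ₀ / 4)) * (10 / δ₀)))) with hΘ
  set M : ℕ := ⌈max (max (kR d N γ₀ c₀ δ₀) (thetaConst d N γ₀ c₀ δ₀)) (4 * Θ)⌉₊ + 5 with hMdef
  have hM5 : 5 ≤ M := by omega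
  have hM0 : 0 < M := by omega
  have hMr : (0 : ℝ) < M := by exact_mod_cast hM0
  have hceil : max (max (kR d N γ₀ c₀ δ₀) (thetaConst d N γ₀ c₀ δ₀)) (4 * Θ) < M := by
    rw [hMdef]
    push_cast
    have := Nat.le_ceil (max (max (kR d N γ₀ c₀ δ₀) (thetaConst d N γ₀ c₀ δ₀)) (4 * Θ))
    linarith
  have hMR : kR d N γ₀ c₀ δ₀ < M := lt_of_le_of_lt ((le_max_left _ _).trans (le_max_left _ _)) hceil
  have hMθ : thetaConst d N γ₀ c₀ δ₀ < M := lt_of_le_of_lt ((le_max_right _ _).trans (le_max_left _ _)) hceil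
  have h4Θ : 4 * Θ < M := lt_of_le_of_lt (le_max_right _ _) hceil
  refine ⟨M, hM0, fun Λ A B D hA hAB hD0 hD1 hB x x' => ?_⟩
  set θ := 3 ^ d * (latticeConst d (δ₀ / 8) * (Real.exp (δ₀ / 8) * alpha515 d N c₀ δ₀ M * γ₀⁻¹)) with hθ
  set κ := 1 + γ₀⁻¹ * (c₀ * (N * latticeConst d δ₀)) with hκ
  have hα := alpha515_nonneg d N hc hδ M
  have hθ0 : 0 ≤ θ := by positivity
  have hκ0 : 0 ≤ κ := by positivity
  have hθle : θ ≤ Θ / M := thetaW_le hγ hc hδ hM0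
  have hθq : θ ≤ 1 / 4 := by
    refine hθle.trans ?_
    rw [div_le_iff₀ hMr]
    have : 0 ≤ Θ := (mul_nonneg hθ0 hMr.le).trans ((le_div_iff₀ hMr).mp hθle)
    linarith
  have h2θ : 2 * θ < 1 := by linarith
  have h := abs_inv_sub_inv_apply_le_of_walk hγ hc hδ hA hAB hD0 hD1 hB hM5 hMR hMθ h2θ x x'
  refine h.trans ?_
  have hinv : (1 - 2 * θ)⁻¹ ≤ 2 := by
    rw [inv_le_comm₀ (by linarith) (by norm_num)]
    linarith
  have hE := Real.exp_pos (-(δ₀ / (48 * M) *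
    (dist (x.1 : Fin d → ℤ) (x'.1 : Fin d → ℤ) + D (x.1 : Fin d → ℤ) + D (x'.1 : Fin d → ℤ))))
  calc 2 ^ d * κ * γ₀⁻¹ * Real.exp (δ₀ / 4) * (1 - 2 * θ)⁻¹ * Real.exp (-(δ₀ / (48 * M) *
        (dist (x.1 : Fin d → ℤ) (x'.1 : Fin d → ℤ) + D (x.1 : Fin d → ℤ) + D (x'.1 : Fin d → ℤ))))
      ≤ 2 ^ d * κ * γ₀⁻¹ * Real.exp (δ₀ / 4) * 2 * Real.exp (-(δ₀ / (48 * M) *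
        (dist (x.1 : Fin d → ℤ) (x'.1 : Fin d → ℤ) + D (x.1 : Fin d → ℤ) + D (x'.1 : Fin d → ℤ)))) := by
        gcongr
    _ = _ := by ring

/-- **(5.10) AS PRINTED — *"If we perturb the operator A by an operator B such that the condition (5.6) is satisfied
for A + B, and additionally B has the property (5.9), then we have also |A_Λ^{−1}(x,x′) − (A+B)_Λ^{−1}(x,x′)| ≤
c₁e^{−δ₁(|x−x′| + dist(x,Ω^c) + dist(x′,Ω^c))}, x, x′ ∈ Λ. (5.10)"* — by the walk route**: constants `c₁, δ₁ > 0`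
depending on `d, N, γ₀, c₀, δ₀` only, such that for every finite `Ω ⊂ ℤ^d`, every `A`, `A + B` with (5.6) on
`L²(Ω; ℝ^N)`, every `B` with (5.9) (`B4.Hyp59 Ω B c₀ δ₀`) and EVERY `Λ ⊆ Ω`: `B4.Concl510 Ω Λ h A B c₁ δ₁` ((5.6) passes
to `A_Λ`, `(A+B)_Λ = A_Λ + B_Λ` by `B6GOmega.hyp56_compress`; `dist(·,Ω^c) = Metric.infDist · (Ωᶜ)` is `≥ 0` and
1-Lipschitz). [cite: Balaban1983RegularityDecay, Sect. 5 Theorem (5.9)–(5.10) p.594; p.597] -/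
theorem concl510_compress_walk (d N : ℕ) (hγ : 0 < γ₀) (hc : 0 ≤ c₀) (hδ : 0 < δ₀) :
    ∃ c₁ δ₁ : ℝ, 0 < c₁ ∧ 0 < δ₁ ∧
      ∀ (Ω Λ : Finset (Fin d → ℤ)) (h : Λ ⊆ Ω) (A B : Matrix (B4.Idx Ω N) (B4.Idx Ω N) ℝ),
        B4.Hyp56 Ω A γ₀ c₀ δ₀ → B4.Hyp56 Ω (A + B) γ₀ c₀ δ₀ → B4.Hyp59 Ω B c₀ δ₀ →
          B4.Concl510 Ω Λ h A B c₁ δ₁ := by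
  obtain ⟨M, hM0, hM⟩ := concl510_walk d N hγ hc hδ
  have hMr : (0 : ℝ) < M := by exact_mod_cast hM0
  have hK := latticeConst_nonneg d hδ.le
  refine ⟨2 ^ (d + 1) * (1 + γ₀⁻¹ * (c₀ * (N * latticeConst d δ₀))) * γ₀⁻¹ * Real.exp (δ₀ / 4), δ₀ / (48 * M),
    by positivity, by positivity, ?_⟩
  intro Ω Λ h A B hA hAB hB x x'
  have e : B4.compress h (A + B) = B4.compress h A + B4.compress h B := by
    rw [← compress_add_sub h A B]; abel
  rw [e]
  exact hM Λ (B4.compress h A) (B4.compress h B)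
    (fun y => Metric.infDist y ((Ω : Set (Fin d → ℤ)))ᶜ) (hyp56_compress h hγ.le hc hδ.le hA)
    (by rw [← e]; exact hyp56_compress h hγ.le hc hδ.le hAB) (fun y => Metric.infDist_nonneg)
    (fun y z => Metric.infDist_le_infDist_add_dist) (fun k k' => hB (B4.inclIdx h k) (B4.inclIdx h k')) x x'

end Main

end Literature.MathematicalPhysics.QuantumFieldTheory.Balaban1983to89.B4Sect5WalkPerturb
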